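import Literature.Analysis.FluidPDE.TorusNSSobolevLifespan
import Literature.Analysis.FluidPDE.TorusNSSobolevCommutator
import Literature.Analysis.FunctionSpaces.TorusWienerSobolevInterpolation
import HarnessLib

/-!
# The optimal `Ḣ^{3/2}` blow-up rate `‖u(t)‖_{Ḣ^{3/2}} ≳ (ν/(T − t))^{1/2}` on `T³`
# (Cortissoz–Montero 2015, Thm 2.1): the commutator estimate with an `F_r` factor (their
# Lemma 2.1), the borderline `Ḣ^{3/2}` energy inequality, and the `Ḣ^s` rate law / lifespan /
# window / blow-up rate on the WHOLE range `1/2 < s < 5/2`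

Search for candidate a priori estimates; no regularity claim.

Analysis/FluidPDE proof file (theorems only; no definitions, no named facts). Robinson, Sadowski
and Silva (J. Math. Phys. 53 (2012) 115618, §IV–§V) proved the lower bounds
`‖u(T − t)‖_{Ḣ^s} ≥ c_s t^{−(2s−1)/4}` for `1/2 < s < 5/2`, `s ≠ 3/2`, from the `Ḣ^s` energy
inequality `½ d/dt‖u‖²_s + ‖u‖²_{s+1} ≤ c‖u‖_s^{s+1/2}‖u‖_{s+1}^{5/2−s}`, and at the borderline
`s = 3/2` only the rate `t^{−1/2+ε}` (§V.A; the tree's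
`NSSobolev.hsSeminorm_sq_blowup_rate_three_halves`), because their `F_r`–Sobolev interpolation
(Lemma 3.2) is used at `r ∈ {0, 1}`, where `s = 3/2` is an endpoint. Cortissoz and Montero
(arXiv:1503.03063 (2015) = J. Math. Fluid Mech. (2018), §2; after Cortissoz–Montero–Pinilla,
J. Math. Phys. 55 (2014), who had `c/√((T−t)|log(T−t)|)`) close the gap:

  Theorem 2.1. Let `u` be a solution of the Navier–Stokes equations whose maximum interval of
  existence is `(0, T)`, `u ∈ C((0,T), Ḣ^s(T³) ∩ Ḣ^{s+1}(T³))`, `1/2 < s < 5/2`. Then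
  `C_s / t^{½(s−½)} ≤ ‖u(T − s)‖_{Ḣ^s(T³)}`   (2.1)

with the proof: the energy inequality with an `F_r` factor,
`½ d/dt‖u‖²_s + 4π²‖u‖²_{s+1} ≤ C_s (∑_k|û_k||k|^r) ‖u‖_s ‖u‖_{s+1−r}`, `0 ≤ r ≤ 1` (2.2)
(their Lemma 2.1: the Robinson–Sadowski–Silva commutator argument with the splitting
`|q| = |q|^r|q|^{1−r}`, `|q|^{1−r} ≤ |k−q|^{1−r} + |k|^{1−r}`), the choice `r = ½(s − ½)`, and
Hardy's proof of Carlson's inequality to bound `∑_k|û_k||k|^{½(s−½)}` by a product of powers of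
`‖u‖_s`, `‖u‖_{s+1}` — at `s = 3/2`, `r = 1/2`:
`∑_k|k|^{1/2}|û_k| ≤ c‖u‖_{3/2}^{1/2}‖u‖_{5/2}^{1/2}`,
which is Robinson–Sadowski–Silva's Lemma 3.2 with `s₁ = 3/2 < 3/2 + r = 2 < s₂ = 5/2` (the tree's
`Torus.exists_tsum_rpow_mul_norm_le_interpolation`); then
`½ d/dt‖u‖²_s ≤ c_s(‖u‖²_s)^{1+1/(s−½)}` and "by integrating between `T − t` and `T`" (2.1);
Cor. 2.1: `K_s/‖u₀‖_s^{4/(2s−1)} ≤ T`.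

Here, on the unit torus `T^d`, `card d = 3`, for the tree's classical solutions
`Torus.IsClassicalNSSolutionOn` of the unforced system with mean-zero velocity slices, in the
tree's lattice normalisation (Mathlib's `UnitAddTorus.mFourierCoeff`, characters `e^{2πik·x}`,
`k ∈ ℤ^d`, `∇ ↔ 2πik`, `Δ ↔ −4π²|k|²`; `û(k) = mFourierCoeff (complexify ∘ u) k`,
`|k|^{2t} = (freqNormSq k)^t`, `X_s = ∑_k |k|^{2s}‖û(k)‖² = ‖u‖²_{Ḣ^s}`), with the viscosity kept:

* `NSSobolev.abs_tsum_rpow_mul_re_inner_convect_le_of_rpow` — **Lemma 2.1**: for a smooth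
  divergence-free real field, `s ≥ 1`, `0 ≤ r ≤ 1`,
  `|∑_k |k|^{2s} Re⟪𝓕((u·∇)u)(k), û(k)⟫| ≤ 16π n s 2^s (∑_k|k|^r‖û(k)‖) ‖u‖_{Ḣ^s}‖u‖_{Ḣ^{s+1−r}}`
  (`r = 1` is Robinson–Sadowski–Silva's (3.6), `NSSobolev.abs_tsum_rpow_mul_re_inner_convect_le`);
* `NSSobolev.hsSeminorm_sq_deriv_le_of_eq_three_halves` — **(2.2)–(2.3) at `s = 3/2`**: there
  is `K ≥ 0` with `X' ≤ −8π²ν X_{5/2} + K (√X_{3/2})² √X_{5/2}` along every classical mean-zero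
  solution (Lemma 2.1 at `r = 1/2`, Lemma 3.2 at `(r, s₁, s₂) = (1/2, 3/2, 5/2)`, the Sobolev
  interpolation `X_2 ≤ X_{3/2}^{1/2}X_{5/2}^{1/2}`); hence
* `NSSobolev.hsSeminorm_sq_deriv_le''`, `NSSobolev.hsSeminorm_sq_deriv_le_rpow''` — the `Ḣ^s`
  energy inequality and the rate law
  `X' ≤ −4π²ν X_{s+1} + c ν^{−(5−2s)/(2s−1)} X^{(2s+1)/(2s−1)}` on the WHOLE range `1/2 < s < 5/2`
  (the tree's `'` versions carry `s ≠ 3/2`); at `s = 3/2`: `X' ≤ −4π²ν X_{5/2} + c ν⁻¹ X²`;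
* `NSSobolev.classicalNS_continuation_of_hsSeminorm_lifespan''`,
  `NSSobolev.hsSeminorm_sq_le_of_window''`, `NSSobolev.hsSeminorm_sq_blowup_rate''`,
  `NSSobolev.hsSeminorm_sq_blowup_rate_of_not_bddAbove_gradNormSq''` — lifespan (Cor. 2.1),
  window bound (RSS (4.1)), blow-up rate (Thm 2.1 / RSS (2.2)) under `Ḣ^s`- resp.
  enstrophy-unboundedness, for ALL `1/2 < s < 5/2` (the proofs of `TorusNSSobolevLifespan`,
  verbatim, fed with the borderline-inclusive law);
* `NSSobolev.hsSeminorm_sq_three_halves_blowup_rate`,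
  `NSSobolev.hsSeminorm_sq_three_halves_blowup_rate_of_not_bddAbove_gradNormSq`,
  `NSSobolev.classicalNS_continuation_of_hsSeminorm_three_halves_lifespan` — **Thm 2.1 / Cor 2.1
  at `s = 3/2` in clean form**: `‖u(t)‖²_{Ḣ^{3/2}} ≥ c₀ ν/(T − t)` on `[a, T)` (the OPTIMAL
  exponent `1/2`), and `T·‖u(0)‖²_{Ḣ^{3/2}} ≤ c₀ν ⇒` continuation past `T`.

For the functional-mining cell: closes the `s = 3/2` entry of the `Ḣ^s` yardstick index
(EXTREME-GROWTH G8Σ) with the exact exponent — the rate law a candidate monotone/coercive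
quantity at the `Ḣ^{3/2}` level must beat is `X' ≤ cν⁻¹X²` (not `X^{2+ε}`); a NECESSARY rate and
a short-time lifespan bound, no a priori bound, no regularity claim. What is NOT typed: the
whole-space version (CM Remark 1), the Euler application (CM §3), rough solutions.

## Mathlib / tree search

Tree: `NSSobolev.abs_tsum_rpow_mul_re_inner_convect_le` ((3.6), `r = 1`) and its lemmas
`NSSobolev.mFourierCoeff_convect_apply_eq_tsum`, `NSSobolev.abs_rpow_sqrt_sub_rpow_sqrt_le` ((3.7)),
`NSSobolev.re_tsum_tsum_latticeConvect_eq_zero` (cancellation) (`TorusNSSobolevCommutator`) —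
the proof of Lemma 2.1 here is that proof with the four-term majorant of the `r`-splitting;
`NSGevrey.sum_mul_tsum_mul_le` (Young `ℓ¹ ⋆ ℓ² ⊂ ℓ²`),
`NSSobolev.sum_rpow_mul_norm_mul_norm_convect_le` ((3.5)),
`NSSobolev.hasDerivAt_tsum_rpow_mul_norm_sq`, `NSSobolev.hsSeminorm_sq_deriv_le'`,
`…_rpow'` (`TorusNSSobolevGrowthRate`), `Torus.exists_tsum_rpow_mul_norm_le_interpolation`
(Lemma 3.2), `Torus.tsum_rpow_mul_le_interpolate` (`TorusWienerSobolevInterpolation`),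
`NSSobolev.continuousOn_tsum_rpow_mul_norm_sq`,
`Torus.exists_rpow_integral_rpow_norm_le_hsSeminorm`,
`Torus.classicalNS_continuation_of_Ls_rpow_integral_le` (`TorusNSSobolevLifespan` and its imports).
Searched `three_halves|borderline|Carlson|CortissozMontero`: the tree has the `ε`-loss borderline
rates `NSSobolev.hsSeminorm_sq_blowup_rate_three_halves(_of_not_bddAbove_gradNormSq)`
(`TorusNSSobolevHighRange`, RSS §V.A) and the `s ≠ 3/2` family; no exact-exponent `Ḣ^{3/2}`
rate and no `F_r` commutator estimate for `r < 1`.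

## References

* J. C. Cortissoz, J. A. Montero, *Lower bounds for possible singular solutions for the
  Navier–Stokes and Euler equations revisited*, arXiv:1503.03063 (2015) (J. Math. Fluid Mech.
  20 (2018)), §1 (the display `C/t^{1/2} ≤ ‖u(T−t)‖_{Ḣ^{3/2}(T³)}`), §2 Thm 2.1 (2.1)–(2.3),
  Lemma 2.1, Cor 2.1 (held: paper:arxiv-1503.03063, arXiv source pp. 3–5, READ).
  [CortissozMontero2015]
* J. C. Cortissoz, J. A. Montero, C. E. Pinilla, *On lower bounds for possible blow-up solutions
  to the periodic Navier–Stokes equation*, J. Math. Phys. 55 (2014) 033101 (the almost optimal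
  `Ḣ^{3/2}` rate). [CortissozMonteroPinilla2014]
* A. Cheskidov, K. Zaya, *Lower bounds of potential blow-up solutions of the three-dimensional
  Navier–Stokes equations in `Ḣ^{3/2}`*, J. Math. Phys. 57 (2016) 023101. [CheskidovZaya2016]
* J. C. Robinson, W. Sadowski, R. P. Silva, J. Math. Phys. 53 (2012) 115618, §II (2.2), §III
  (3.5)–(3.7), Lemma 3.2, §IV (4.1)–(4.2), §V.A (held: paper:doi-10-1063-1-4762841).
  [RobinsonSadowskiSilva2012]
-/

noncomputable section

open MeasureTheory Set Filter UnitAddTorus Function Finset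
open scoped Topology BigOperators InnerProductSpace ComplexConjugate

namespace Literature.Analysis.FluidPDE

namespace NSSobolev

open Literature.Analysis.FunctionSpaces Literature.Analysis.FunctionSpaces.Torus NSGevrey

variable {d : Type*} [Fintype d] [DecidableEq d]

variable {u : UnitAddTorus d → EuclideanSpace ℝ d}

/-! ### §1 The commutator estimate with an `F_r` factor, `0 ≤ r ≤ 1`
(Cortissoz–Montero Lemma 2.1) -/

omit [Fintype d] [DecidableEq d] in
/-- Summability over `ℤ^n × ℤ^n` of `(k, l) ↦ α_k β_l δ_{k−l}` for nonnegative `α, β ∈ ℓ¹` and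
bounded `δ`. [folklore] -/
private theorem summable_prod_mul_mul_sub' {α β δ : (d → ℤ) → ℝ} (hα0 : ∀ k, 0 ≤ α k)
    (hβ0 : ∀ l, 0 ≤ β l) (hδ0 : ∀ m, 0 ≤ δ m) (hα : Summable α) (hβ : Summable β) {D : ℝ}
    (hδ : ∀ m, δ m ≤ D) :
    Summable fun q : (d → ℤ) × (d → ℤ) => α q.1 * (β q.2 * δ (q.1 - q.2)) := by
  have h0 : ∀ q : (d → ℤ) × (d → ℤ), 0 ≤ α q.1 * (β q.2 * δ (q.1 - q.2)) := fun q =>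
    mul_nonneg (hα0 _) (mul_nonneg (hβ0 _) (hδ0 _))
  have hle : ∀ k l, α k * (β l * δ (k - l)) ≤ α k * D * β l := fun k l => by
    calc α k * (β l * δ (k - l)) ≤ α k * (β l * D) :=
          mul_le_mul_of_nonneg_left (mul_le_mul_of_nonneg_left (hδ _) (hβ0 l)) (hα0 k)
      _ = α k * D * β l := by ring
  have hfib : ∀ k, Summable fun l => α k * (β l * δ (k - l)) := fun k =>
    (hβ.mul_left (α k * D)).of_nonneg_of_le (fun l => h0 (k, l)) (hle k)
  refine (summable_prod_of_nonneg fun q => h0 q).2 ⟨hfib, ?_⟩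
  refine (hα.mul_right (D * ∑' l, β l)).of_nonneg_of_le (fun k => tsum_nonneg fun l => h0 (k, l))
    fun k => ?_
  calc ∑' l, α k * (β l * δ (k - l)) ≤ ∑' l, α k * D * β l :=
        (hfib k).tsum_le_tsum (hle k) (hβ.mul_left _)
    _ = α k * (D * ∑' l, β l) := by rw [tsum_mul_left]; ring

omit [Fintype d] [DecidableEq d] in
/-- `(m + b)^p ≤ 2^p (m^p + b^p)` for `m, b ≥ 0`, `p ≥ 0`. [folklore] -/
private theorem add_rpow_le_two_rpow_mul {m b p : ℝ} (hm : 0 ≤ m) (hb : 0 ≤ b) (hp : 0 ≤ p) :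
    (m + b) ^ p ≤ (2 : ℝ) ^ p * (m ^ p + b ^ p) := by
  have hM0 : 0 ≤ max m b := le_max_of_le_left hm
  calc (m + b) ^ p ≤ (2 * max m b) ^ p :=
        Real.rpow_le_rpow (by positivity) (by linarith [le_max_left m b, le_max_right m b]) hp
    _ = (2 : ℝ) ^ p * (max m b) ^ p := Real.mul_rpow (by norm_num) hM0
    _ ≤ (2 : ℝ) ^ p * (m ^ p + b ^ p) := by
        refine mul_le_mul_of_nonneg_left ?_ (by positivity)
        rcases le_total m b with h | h
        · rw [max_eq_right h]; linarith [Real.rpow_nonneg hm p]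
        · rw [max_eq_left h]; linarith [Real.rpow_nonneg hb p]

/-- **Cortissoz–Montero's Lemma 2.1 — the Robinson–Sadowski–Silva commutator estimate with an
`F_r` factor** ("For any `s > 1` and `0 ≤ r ≤ 1`, we have
`|∑_k ∑_q |k|^{2s}(k·û_{k−q})(û_q·ū_k)| ≤ c_s (∑_k |k|^r|û_k|) ‖u‖_s ‖u‖_{s+1−r}`";
proof: the cancellation `(B(u,Λ^s u),Λ^s u) = 0`, the commutator bound
`||k|^s − |q|^s| ≤ s2^{s−1}|k−q|(|k−q|^{s−1} + |q|^{s−1})`, the splitting `|q| = |q|^r|q|^{1−r}`,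
`|q|^{1−r} ≤ |k−q|^{1−r} + |k|^{1−r}`, and Cauchy–Schwarz in `k`). Lattice form on `T^n`: for a
smooth divergence-free real field `u`, `s ≥ 1` and `0 ≤ r ≤ 1`,
`|∑_k |k|^{2s} Re⟪𝓕((u·∇)u)(k), û(k)⟫| ≤ 16π n s 2^s (∑_k |k|^r‖û(k)‖) ‖u‖_{Ḣ^s} ‖u‖_{Ḣ^{s+1−r}}`
(`|k|^t = (freqNormSq k)^{t/2}`, `‖u‖²_{Ḣ^t} = ∑_k |k|^{2t}‖û(k)‖²`; at `r = 1` this is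
Robinson–Sadowski–Silva's (3.6), `NSSobolev.abs_tsum_rpow_mul_re_inner_convect_le`).
[cite: CortissozMontero2015, §2 Lemma 2.1 (arXiv p. 4–5);
RobinsonSadowskiSilva2012, §III (3.6)–(3.7)] -/
theorem abs_tsum_rpow_mul_re_inner_convect_le_of_rpow (hu : IsSmooth u) (hdiv : IsDivFree u)
    {s r : ℝ} (hs : 1 ≤ s) (hr : 0 ≤ r) (hr1 : r ≤ 1) :
    |∑' k : d → ℤ, freqNormSq k ^ s *
        (inner ℂ (mFourierCoeff (EuclideanSpace.complexify ∘ Torus.convect u u) k)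
          (mFourierCoeff (EuclideanSpace.complexify ∘ u) k)).re| ≤
      16 * Real.pi * (Fintype.card d : ℝ) * (s * (2 : ℝ) ^ s) *
        (∑' k : d → ℤ, freqNormSq k ^ (r / 2) *
          ‖mFourierCoeff (EuclideanSpace.complexify ∘ u) k‖) *
        (Real.sqrt (∑' k : d → ℤ, freqNormSq k ^ s *
            ‖mFourierCoeff (EuclideanSpace.complexify ∘ u) k‖ ^ 2) *
          Real.sqrt (∑' k : d → ℤ, freqNormSq k ^ (s + 1 - r) *
            ‖mFourierCoeff (EuclideanSpace.complexify ∘ u) k‖ ^ 2)) := by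
  classical
  set U : (d → ℤ) → EuclideanSpace ℂ d := fun m => mFourierCoeff (EuclideanSpace.complexify ∘ u) m
    with hUdef
  -- ### weights and their summability
  set a : (d → ℤ) → ℝ := fun m => ‖U m‖ with ha
  set r1 : (d → ℤ) → ℝ := fun m => Real.sqrt (freqNormSq m) with hr1def
  set rr : (d → ℤ) → ℝ := fun m => freqNormSq m ^ (r / 2) with hrr
  set qq : (d → ℤ) → ℝ := fun m => freqNormSq m ^ ((1 - r) / 2) with hqq
  set ρ : (d → ℤ) → ℝ := fun m => freqNormSq m ^ (s / 2) with hρ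
  set ρ₁ : (d → ℤ) → ℝ := fun m => freqNormSq m ^ ((s - 1) / 2) with hρ₁
  set ρ'' : (d → ℤ) → ℝ := fun m => freqNormSq m ^ ((s + 1 - r) / 2) with hρ''
  set b : (d → ℤ) → ℝ := fun m => ρ m * a m with hb
  set b'' : (d → ℤ) → ℝ := fun m => ρ'' m * a m with hb''
  set ar : (d → ℤ) → ℝ := fun m => rr m * a m with har
  have ha0 : ∀ m, 0 ≤ a m := fun m => norm_nonneg _
  have hr10 : ∀ m, 0 ≤ r1 m := fun m => Real.sqrt_nonneg _
  have hrr0 : ∀ m, 0 ≤ rr m := fun m => Real.rpow_nonneg (freqNormSq_nonneg m) _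
  have hqq0 : ∀ m, 0 ≤ qq m := fun m => Real.rpow_nonneg (freqNormSq_nonneg m) _
  have hρ0 : ∀ m, 0 ≤ ρ m := fun m => Real.rpow_nonneg (freqNormSq_nonneg m) _
  have hρ₁0 : ∀ m, 0 ≤ ρ₁ m := fun m => Real.rpow_nonneg (freqNormSq_nonneg m) _
  have hρ''0 : ∀ m, 0 ≤ ρ'' m := fun m => Real.rpow_nonneg (freqNormSq_nonneg m) _
  have hb0 : ∀ m, 0 ≤ b m := fun m => mul_nonneg (hρ0 m) (ha0 m)
  have hb''0 : ∀ m, 0 ≤ b'' m := fun m => mul_nonneg (hρ''0 m) (ha0 m)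
  have har0 : ∀ m, 0 ≤ ar m := fun m => mul_nonneg (hrr0 m) (ha0 m)
  have hRD := hu.complexify_comp.rapidDecay_mFourierCoeff
  have has : Summable a := hRD.summable_norm
  -- `∑ |m|^{2t}·‖û m‖ < ∞` for every `t ≥ 0`
  have hpow : ∀ {t : ℝ}, 0 ≤ t → Summable fun m : d → ℤ => freqNormSq m ^ t * a m := by
    intro t ht
    obtain ⟨N, hN⟩ := exists_nat_ge t
    refine (hRD N).of_nonneg_of_le (fun m => mul_nonneg (Real.rpow_nonneg (freqNormSq_nonneg m) _)
      (ha0 m)) fun m => ?_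
    refine mul_le_mul_of_nonneg_right ?_ (ha0 m)
    calc freqNormSq m ^ t ≤ (1 + freqNormSq m) ^ t :=
          Real.rpow_le_rpow (freqNormSq_nonneg m) (by linarith) ht
      _ ≤ (1 + freqNormSq m) ^ (N : ℝ) :=
          Real.rpow_le_rpow_of_exponent_le (by linarith [freqNormSq_nonneg m]) hN
      _ = (1 + freqNormSq m) ^ N := Real.rpow_natCast _ _
  have hr1_eq : ∀ m, r1 m = freqNormSq m ^ (1 / 2 : ℝ) := fun m => Real.sqrt_eq_rpow _
  -- exponent algebra
  have hrρ₁ : ∀ m, r1 m * ρ₁ m = ρ m := fun m => by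
    rw [hr1_eq, hρ₁, hρ]
    simp only
    rw [← Real.rpow_add' (freqNormSq_nonneg m) (by linarith : (1 / 2 : ℝ) + (s - 1) / 2 ≠ 0)]
    congr 1
    ring
  have hρsq : ∀ m, ρ m * ρ m = freqNormSq m ^ s := fun m => by
    rw [hρ]
    simp only
    rw [← Real.rpow_add' (freqNormSq_nonneg m) (by linarith : s / 2 + s / 2 ≠ 0)]
    congr 1
    ring
  have hρ''sq : ∀ m, ρ'' m * ρ'' m = freqNormSq m ^ (s + 1 - r) := fun m => by
    rw [hρ'']
    simp only
    rw [← Real.rpow_add' (freqNormSq_nonneg m)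
      (by linarith : (s + 1 - r) / 2 + (s + 1 - r) / 2 ≠ 0)]
    congr 1
    ring
  have hqρ : ∀ m, qq m * ρ m = ρ'' m := fun m => by
    rw [hqq, hρ, hρ'']
    simp only
    rcases eq_or_ne (freqNormSq m) 0 with h0 | h0
    · -- at the origin both sides vanish unless an exponent is zero; use `rpow_add'` when legal
      by_cases he : (1 - r) / 2 + s / 2 = 0
      · exfalso; linarith
      · rw [← Real.rpow_add' (freqNormSq_nonneg m) he]; congr 1; ring
    · rw [← Real.rpow_add (lt_of_le_of_ne (freqNormSq_nonneg m) (Ne.symm h0))]; congr 1; ring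
  -- `r1 = rr * qq` (splitting `|m| = |m|^r |m|^{1−r}`)
  have hr1_split : ∀ m, r1 m = rr m * qq m := fun m => by
    rw [hr1_eq, hrr, hqq]
    simp only
    rw [← Real.rpow_add' (freqNormSq_nonneg m) (by linarith : r / 2 + (1 - r) / 2 ≠ 0)]
    congr 1
    ring
  -- `qq l ≤ 2 (qq (k - l) + qq k)` and `qq (k - l) ≤ 2 (qq l + qq k)` (triangle inequality)
  have h1r : 0 ≤ 1 - r := by linarith
  have hqq_eq : ∀ m, qq m = r1 m ^ (1 - r) := fun m => by
    rw [hqq, hr1def]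
    simp only
    rw [Real.sqrt_eq_rpow, ← Real.rpow_mul (freqNormSq_nonneg m)]
    congr 1
    ring
  have h2le : (2 : ℝ) ^ (1 - r) ≤ 2 := by
    calc (2 : ℝ) ^ (1 - r) ≤ (2 : ℝ) ^ (1 : ℝ) :=
          Real.rpow_le_rpow_of_exponent_le (by norm_num) (by linarith)
      _ = 2 := Real.rpow_one 2
  have hqq_tri : ∀ k l, qq l ≤ 2 * (qq (k - l) + qq k) := by
    intro k l
    have htri : r1 l ≤ r1 (k - l) + r1 k := by
      have h := NSGevrey.sqrt_freqNormSq_add_le (l - k) k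
      rw [sub_add_cancel, show l - k = -(k - l) by abel, freqNormSq_neg] at h
      exact h
    rw [hqq_eq, hqq_eq, hqq_eq]
    calc r1 l ^ (1 - r) ≤ (r1 (k - l) + r1 k) ^ (1 - r) := Real.rpow_le_rpow (hr10 l) htri h1r
      _ ≤ (2 : ℝ) ^ (1 - r) * (r1 (k - l) ^ (1 - r) + r1 k ^ (1 - r)) :=
          add_rpow_le_two_rpow_mul (hr10 _) (hr10 _) h1r
      _ ≤ 2 * (r1 (k - l) ^ (1 - r) + r1 k ^ (1 - r)) :=
          mul_le_mul_of_nonneg_right h2le (add_nonneg (Real.rpow_nonneg (hr10 _) _)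
            (Real.rpow_nonneg (hr10 _) _))
  have hqq_tri' : ∀ k l, qq (k - l) ≤ 2 * (qq l + qq k) := by
    intro k l
    have h := hqq_tri k (k - l)
    rwa [sub_sub_cancel] at h
  -- summability of the weighted families
  have hbs : Summable b := (hpow (by linarith : (0 : ℝ) ≤ s / 2)).congr fun m => by
    simp only [hb, hρ]
  have hb''s : Summable b'' := (hpow (by linarith : (0 : ℝ) ≤ (s + 1 - r) / 2)).congr fun m => by
    simp only [hb'', hρ'']
  have hars : Summable ar := (hpow (by linarith : (0 : ℝ) ≤ r / 2)).congr fun m => by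
    simp only [har, hrr]
  have hrbs : Summable fun m => r1 m * b m :=
    (hpow (by linarith : (0 : ℝ) ≤ (s + 1) / 2)).congr fun m => by
      simp only [hb, hr1_eq, hρ]
      rw [← mul_assoc, ← Real.rpow_add' (freqNormSq_nonneg m)
        (by linarith : (1 / 2 : ℝ) + s / 2 ≠ 0)]
      congr 2
      ring
  have hb2 : ∀ m, b m ^ 2 = freqNormSq m ^ s * ‖U m‖ ^ 2 := fun m => by
    simp only [hb, ha]
    rw [mul_pow, sq, hρsq]
  have hb''2 : ∀ m, b'' m ^ 2 = freqNormSq m ^ (s + 1 - r) * ‖U m‖ ^ 2 := fun m => by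
    simp only [hb'', ha]
    rw [mul_pow, sq, hρ''sq]
  have hb2s : Summable fun m => b m ^ 2 :=
    (hu.summable_freqNormSq_rpow_mul_norm_sq (by linarith : (0 : ℝ) ≤ s)).congr
      fun m => (hb2 m).symm
  have hb''2s : Summable fun m => b'' m ^ 2 :=
    (hu.summable_freqNormSq_rpow_mul_norm_sq (by linarith : (0 : ℝ) ≤ s + 1 - r)).congr
      fun m => (hb''2 m).symm
  set X : ℝ := ∑' k, freqNormSq k ^ s * ‖U k‖ ^ 2 with hX
  set X'' : ℝ := ∑' k, freqNormSq k ^ (s + 1 - r) * ‖U k‖ ^ 2 with hX''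
  set Fr : ℝ := ∑' k, ar k with hFr
  have hXb : ∑' m, b m ^ 2 = X := tsum_congr hb2
  have hX''b : ∑' m, b'' m ^ 2 = X'' := tsum_congr hb''2
  have hX0 : 0 ≤ X := by rw [← hXb]; exact tsum_nonneg fun m => sq_nonneg _
  have hX''0 : 0 ≤ X'' := by rw [← hX''b]; exact tsum_nonneg fun m => sq_nonneg _
  have hFr0 : 0 ≤ Fr := tsum_nonneg fun m => har0 m
  -- bounds `a ≤ A`, `b ≤ B₀`, `b'' ≤ B''`, `ar ≤ Fr`
  have hAle : ∀ m, a m ≤ ∑' j, a j := fun m => has.le_tsum m fun j _ => ha0 j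
  have hBle : ∀ m, b m ≤ ∑' j, b j := fun m => hbs.le_tsum m fun j _ => hb0 j
  have hB''le : ∀ m, b'' m ≤ ∑' j, b'' j := fun m => hb''s.le_tsum m fun j _ => hb''0 j
  have hArle : ∀ m, ar m ≤ Fr := fun m => hars.le_tsum m fun j _ => har0 j
  -- ### the pieces on `ℤ^n × ℤ^n`
  set W : (d → ℤ) → EuclideanSpace ℂ d := fun k => (ρ k : ℂ) • U k with hW
  have hWn : ∀ k, ‖W k‖ = b k := fun k => by
    simp only [hW, hb, ha]
    rw [norm_smul, Complex.norm_real, Real.norm_of_nonneg (hρ0 k)]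
  set c : (d → ℤ) → (d → ℤ) → ℂ := fun k l =>
    2 * Real.pi * Complex.I * ∑ j, ((l j : ℤ) : ℂ) * U (k - l) j with hc
  set Φ : (d → ℤ) × (d → ℤ) → ℂ := fun q =>
    (2 * Real.pi * Complex.I * ∑ j, ((q.2 j : ℤ) : ℂ) * U (q.1 - q.2) j) *
      inner ℂ (W q.1) (W q.2) with hΦ
  set E : (d → ℤ) × (d → ℤ) → ℂ := fun q =>
    c q.1 q.2 * (((ρ q.1 * (ρ q.1 - ρ q.2) : ℝ)) : ℂ) * inner ℂ (U q.1) (U q.2) with hE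
  set C : ℝ := 2 * Real.pi * (Fintype.card d : ℝ) * (s * (2 : ℝ) ^ s) * 2 with hC
  have hC0 : 0 ≤ C := by positivity
  set G : (d → ℤ) × (d → ℤ) → ℝ := fun q =>
    C * (b q.1 * (ar q.2 * b'' (q.1 - q.2)) + b'' q.1 * (ar q.2 * b (q.1 - q.2)) +
      (b q.1 * (b'' q.2 * ar (q.1 - q.2)) + b'' q.1 * (b q.2 * ar (q.1 - q.2)))) with hG
  -- `|c k l| ≤ 2π n |l| ‖û(k−l)‖`
  have h2π : ‖(2 * Real.pi * Complex.I : ℂ)‖ = 2 * Real.pi := by simp [abs_of_pos Real.pi_pos]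
  have hcle : ∀ k l, ‖c k l‖ ≤ 2 * Real.pi * (Fintype.card d : ℝ) * (r1 l * a (k - l)) := by
    intro k l
    simp only [hc]
    rw [norm_mul, h2π]
    have h1 : ‖∑ j, ((l j : ℤ) : ℂ) * U (k - l) j‖ ≤ (Fintype.card d : ℝ) * (r1 l * a (k - l)) := by
      refine (norm_sum_le _ _).trans ?_
      calc ∑ j, ‖((l j : ℤ) : ℂ) * U (k - l) j‖ ≤ ∑ _j : d, r1 l * a (k - l) :=
            Finset.sum_le_sum fun j _ => by
              rw [norm_mul, Complex.norm_intCast]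
              exact mul_le_mul (abs_apply_le_sqrt_freqNormSq l j)
                (PiLp.norm_apply_le (U (k - l)) j) (norm_nonneg _) (Real.sqrt_nonneg _)
        _ = (Fintype.card d : ℝ) * (r1 l * a (k - l)) := by
            rw [Finset.sum_const, Finset.card_univ, nsmul_eq_mul]
    calc 2 * Real.pi * ‖∑ j, ((l j : ℤ) : ℂ) * U (k - l) j‖
        ≤ 2 * Real.pi * ((Fintype.card d : ℝ) * (r1 l * a (k - l))) :=
          mul_le_mul_of_nonneg_left h1 (by positivity)
      _ = 2 * Real.pi * (Fintype.card d : ℝ) * (r1 l * a (k - l)) := by ring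
  -- `‖E(k,l)‖ ≤ G(k,l)`
  have hEle : ∀ q : (d → ℤ) × (d → ℤ), ‖E q‖ ≤ G q := by
    rintro ⟨k, l⟩
    simp only [hE, hG]
    rw [norm_mul, norm_mul, Complex.norm_real, Real.norm_eq_abs, abs_mul, abs_of_nonneg (hρ0 k)]
    have h1 := hcle k l
    have h2 : |ρ k - ρ l| ≤ s * (2 : ℝ) ^ s * r1 (k - l) * (ρ₁ (k - l) + ρ₁ l) :=
      abs_rpow_sqrt_sub_rpow_sqrt_le hs k l
    have h3 : ‖inner ℂ (U k) (U l)‖ ≤ a k * a l := norm_inner_le_norm _ _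
    have hn1 : 0 ≤ ρ k * |ρ k - ρ l| := mul_nonneg (hρ0 k) (abs_nonneg _)
    have hn2 : 0 ≤ 2 * Real.pi * (Fintype.card d : ℝ) * (r1 l * a (k - l)) := by
      have := hr10 l; have := ha0 (k - l); positivity
    have hs0 : (0 : ℝ) ≤ s := by linarith
    have hn3 : 0 ≤ (2 * Real.pi * (Fintype.card d : ℝ) * (r1 l * a (k - l))) *
        (ρ k * (s * (2 : ℝ) ^ s * r1 (k - l) * (ρ₁ (k - l) + ρ₁ l))) := by
      have := hr10 (k - l); have := hρ₁0 (k - l); have := hρ₁0 l; have := hρ0 k; have := hr10 l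
      have := ha0 (k - l)
      positivity
    have h4 : ‖c k l‖ * (ρ k * |ρ k - ρ l|) * ‖inner ℂ (U k) (U l)‖ ≤
        (2 * Real.pi * (Fintype.card d : ℝ) * (r1 l * a (k - l))) *
          (ρ k * (s * (2 : ℝ) ^ s * r1 (k - l) * (ρ₁ (k - l) + ρ₁ l))) * (a k * a l) :=
      mul_le_mul (mul_le_mul h1 (mul_le_mul_of_nonneg_left h2 (hρ0 k)) hn1 hn2) h3
        (norm_nonneg _) hn3
    refine h4.trans ?_
    -- expand: two terms `T₁ = ρ_k a_k · r1_l a_l · ρ(k−l) a(k−l)`,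
    -- `T₂ = ρ_k a_k · ρ_l a_l · r1(k−l) a(k−l)`
    have e1 : r1 (k - l) * ρ₁ (k - l) = ρ (k - l) := hrρ₁ (k - l)
    have e2 : r1 l * ρ₁ l = ρ l := hrρ₁ l
    set C₀ : ℝ := 2 * Real.pi * (Fintype.card d : ℝ) * (s * (2 : ℝ) ^ s) with hC₀
    have hC₀0 : 0 ≤ C₀ := by positivity
    have hlhs : (2 * Real.pi * (Fintype.card d : ℝ) * (r1 l * a (k - l))) *
        (ρ k * (s * (2 : ℝ) ^ s * r1 (k - l) * (ρ₁ (k - l) + ρ₁ l))) * (a k * a l) =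
        C₀ * (b k * (r1 l * a l) * b (k - l)) + C₀ * (b k * b l * (r1 (k - l) * a (k - l))) := by
      simp only [hb, hC₀]
      rw [← e1, ← e2]
      ring
    rw [hlhs]
    -- `r1 l a_l ≤ 2 ar_l (qq(k−l) + qq k)` etc.
    have hT1 : b k * (r1 l * a l) * b (k - l) ≤
        2 * (b k * (ar l * b'' (k - l)) + b'' k * (ar l * b (k - l))) := by
      have hq := hqq_tri k l
      have h5 : r1 l * a l ≤ 2 * (ar l * (qq (k - l) + qq k)) := by
        rw [hr1_split l]
        simp only [har]
        calc rr l * qq l * a l = rr l * a l * qq l := by ring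
          _ ≤ rr l * a l * (2 * (qq (k - l) + qq k)) :=
              mul_le_mul_of_nonneg_left hq (mul_nonneg (hrr0 l) (ha0 l))
          _ = 2 * (rr l * a l * (qq (k - l) + qq k)) := by ring
      have e3 : qq (k - l) * b (k - l) = b'' (k - l) := by
        simp only [hb, hb'']; rw [← mul_assoc, hqρ]
      have e4 : qq k * b k = b'' k := by
        simp only [hb, hb'']; rw [← mul_assoc, hqρ]
      calc b k * (r1 l * a l) * b (k - l) ≤ b k * (2 * (ar l * (qq (k - l) + qq k))) * b (k - l) :=
            mul_le_mul_of_nonneg_right (mul_le_mul_of_nonneg_left h5 (hb0 k)) (hb0 _)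
        _ = 2 * (b k * (ar l * (qq (k - l) * b (k - l))) + (qq k * b k) * (ar l * b (k - l))) := by
            ring
        _ = _ := by rw [e3, e4]
    have hT2 : b k * b l * (r1 (k - l) * a (k - l)) ≤
        2 * (b k * (b'' l * ar (k - l)) + b'' k * (b l * ar (k - l))) := by
      have hq := hqq_tri' k l
      have h5 : r1 (k - l) * a (k - l) ≤ 2 * (ar (k - l) * (qq l + qq k)) := by
        rw [hr1_split (k - l)]
        simp only [har]
        calc rr (k - l) * qq (k - l) * a (k - l) = rr (k - l) * a (k - l) * qq (k - l) := by ring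
          _ ≤ rr (k - l) * a (k - l) * (2 * (qq l + qq k)) :=
              mul_le_mul_of_nonneg_left hq (mul_nonneg (hrr0 _) (ha0 _))
          _ = 2 * (rr (k - l) * a (k - l) * (qq l + qq k)) := by ring
      have e3 : qq l * b l = b'' l := by
        simp only [hb, hb'']; rw [← mul_assoc, hqρ]
      have e4 : qq k * b k = b'' k := by
        simp only [hb, hb'']; rw [← mul_assoc, hqρ]
      calc b k * b l * (r1 (k - l) * a (k - l)) ≤ b k * b l * (2 * (ar (k - l) * (qq l + qq k))) :=
            mul_le_mul_of_nonneg_left h5 (mul_nonneg (hb0 k) (hb0 l))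
        _ = 2 * (b k * ((qq l * b l) * ar (k - l)) + (qq k * b k) * (b l * ar (k - l))) := by ring
        _ = _ := by rw [e3, e4]
    have := add_le_add (mul_le_mul_of_nonneg_left hT1 hC₀0) (mul_le_mul_of_nonneg_left hT2 hC₀0)
    refine this.trans (le_of_eq ?_)
    simp only [hC, hC₀]
    ring
  -- summability over pairs
  have hG0 : ∀ q : (d → ℤ) × (d → ℤ), 0 ≤ G q := fun q =>
    mul_nonneg hC0 (add_nonneg
      (add_nonneg (mul_nonneg (hb0 _) (mul_nonneg (har0 _) (hb''0 _)))
        (mul_nonneg (hb''0 _) (mul_nonneg (har0 _) (hb0 _))))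
      (add_nonneg (mul_nonneg (hb0 _) (mul_nonneg (hb''0 _) (har0 _)))
        (mul_nonneg (hb''0 _) (mul_nonneg (hb0 _) (har0 _)))))
  have hGs : Summable G := by
    have h1 := summable_prod_mul_mul_sub' hb0 har0 hb''0 hbs hars hB''le
    have h2 := summable_prod_mul_mul_sub' hb''0 har0 hb0 hb''s hars hBle
    have h3 := summable_prod_mul_mul_sub' hb0 hb''0 har0 hbs hb''s hArle
    have h4 := summable_prod_mul_mul_sub' hb''0 hb0 har0 hb''s hbs hArle
    exact (((h1.add h2).add (h3.add h4)).mul_left C).congr fun q => by simp only [hG]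
  have hEs : Summable E := Summable.of_norm_bounded hGs hEle
  have hΦsum : Summable fun q : (d → ℤ) × (d → ℤ) =>
      ‖W q.1‖ * ((Real.sqrt (freqNormSq q.2) * ‖W q.2‖) * ‖U (q.1 - q.2)‖) := by
    have h1 := summable_prod_mul_mul_sub' hb0 (fun l => mul_nonneg (hr10 l) (hb0 l)) ha0 hbs hrbs
      hAle
    exact h1.congr fun q => by simp only [hWn, hr1def, ha]
  have hΦs : Summable Φ := by
    have hΦle : ∀ q : (d → ℤ) × (d → ℤ), ‖Φ q‖ ≤ 2 * Real.pi * (Fintype.card d : ℝ) *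
        (‖W q.1‖ * ((Real.sqrt (freqNormSq q.2) * ‖W q.2‖) * ‖U (q.1 - q.2)‖)) := by
      rintro ⟨k, l⟩
      simp only [hΦ]
      rw [norm_mul]
      have h1 := hcle k l
      have h2 : ‖inner ℂ (W k) (W l)‖ ≤ ‖W k‖ * ‖W l‖ := norm_inner_le_norm _ _
      calc ‖c k l‖ * ‖inner ℂ (W k) (W l)‖
          ≤ (2 * Real.pi * (Fintype.card d : ℝ) * (r1 l * a (k - l))) * (‖W k‖ * ‖W l‖) :=
            mul_le_mul h1 h2 (norm_nonneg _) (by positivity)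
        _ = 2 * Real.pi * (Fintype.card d : ℝ) * (‖W k‖ * ((r1 l * ‖W l‖) * a (k - l))) := by ring
    exact Summable.of_norm_bounded (hΦsum.mul_left _) hΦle
  -- ### the convective coefficient as a series in `l = k − m`
  have hB : ∀ k p, mFourierCoeff (EuclideanSpace.complexify ∘ Torus.convect u u) k p =
      ∑' l, c k l * U l p := by
    intro k p
    rw [mFourierCoeff_convect_apply_eq_tsum hu hu k p,
      ← (Equiv.subLeft k).tsum_eq (fun m => (2 * Real.pi * Complex.I *
        ∑ j, (((k - m) j : ℤ) : ℂ) * U m j) * U (k - m) p)]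
    refine tsum_congr fun l => ?_
    simp only [Equiv.subLeft_apply, sub_sub_cancel, hc]
  have hcUs : ∀ k p, Summable fun l => c k l * U l p := by
    intro k p
    have hr1as : Summable fun l => r1 l * a l :=
      (hpow (by norm_num : (0 : ℝ) ≤ 1 / 2)).congr fun m => by simp only [hr1_eq]
    refine Summable.of_norm_bounded ((hr1as.mul_left (2 * Real.pi * (Fintype.card d : ℝ) *
      ∑' j, a j))) fun l => ?_
    rw [norm_mul]
    calc ‖c k l‖ * ‖U l p‖ ≤ (2 * Real.pi * (Fintype.card d : ℝ) * (r1 l * a (k - l))) * a l :=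
          mul_le_mul (hcle k l) (PiLp.norm_apply_le (U l) p) (norm_nonneg _) (by positivity)
      _ ≤ (2 * Real.pi * (Fintype.card d : ℝ) * (r1 l * ∑' j, a j)) * a l := by
          gcongr
          exact hAle (k - l)
      _ = 2 * Real.pi * (Fintype.card d : ℝ) * (∑' j, a j) * (r1 l * a l) := by ring
  have hinner : ∀ k,
      inner ℂ (U k) (mFourierCoeff (EuclideanSpace.complexify ∘ Torus.convect u u) k) =
      ∑' l, c k l * inner ℂ (U k) (U l) := by
    intro k
    rw [PiLp.inner_apply]
    simp_rw [RCLike.inner_apply', hB k]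
    rw [show (∑ p, conj (U k p) * ∑' l, c k l * U l p) = ∑ p, ∑' l, conj (U k p) * (c k l * U l p)
      from Finset.sum_congr rfl fun p _ => (tsum_mul_left).symm]
    rw [← Summable.tsum_finsetSum fun p _ => (hcUs k p).mul_left _]
    refine tsum_congr fun l => ?_
    rw [PiLp.inner_apply, Finset.mul_sum]
    exact Finset.sum_congr rfl fun p _ => by rw [RCLike.inner_apply']; ring
  -- ### the termwise splitting `|k|^{2s} Re⟪B̂(k), û(k)⟫ = Re ∑_l E(k,l) + Re ∑_l Φ(k,l)`
  have hEfib : ∀ k, Summable fun l => E (k, l) := fun k => hEs.prod_factor k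
  have hΦfib : ∀ k, Summable fun l => Φ (k, l) := fun k => hΦs.prod_factor k
  have hsplit : ∀ k, freqNormSq k ^ s *
      (inner ℂ (mFourierCoeff (EuclideanSpace.complexify ∘ Torus.convect u u) k) (U k)).re =
      (∑' l, E (k, l)).re + (∑' l, Φ (k, l)).re := by
    intro k
    have hsym : (inner ℂ (mFourierCoeff (EuclideanSpace.complexify ∘ Torus.convect u u) k)
        (U k)).re = (inner ℂ (U k)
          (mFourierCoeff (EuclideanSpace.complexify ∘ Torus.convect u u) k)).re := by
      rw [← inner_conj_symm, Complex.conj_re]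
    rw [hsym, hinner k, ← Complex.re_ofReal_mul, ← Complex.add_re,
      ← (hEfib k).tsum_add (hΦfib k), ← tsum_mul_left]
    congr 1
    refine tsum_congr fun l => ?_
    simp only [hE, hΦ, hW, hc]
    rw [inner_smul_left, inner_smul_right, Complex.conj_ofReal, ← hρsq k]
    push_cast
    ring
  -- ### summation over `k`
  have hGfib : ∀ k, Summable fun l => G (k, l) := fun k => hGs.prod_factor k
  have hEre_le : ∀ k, ‖(∑' l, E (k, l)).re‖ ≤ ∑' l, G (k, l) := fun k => by
    rw [Real.norm_eq_abs]
    calc |(∑' l, E (k, l)).re| ≤ ‖∑' l, E (k, l)‖ := Complex.abs_re_le_norm _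
      _ ≤ ∑' l, ‖E (k, l)‖ := norm_tsum_le_tsum_norm (hEfib k).norm
      _ ≤ ∑' l, G (k, l) := (hEfib k).norm.tsum_le_tsum (fun l => hEle (k, l)) (hGfib k)
  have hEre_s : Summable fun k => (∑' l, E (k, l)).re :=
    Summable.of_norm_bounded hGs.prod hEre_le
  have hΦre_s : Summable fun k => (∑' l, Φ (k, l)).re :=
    (Complex.hasSum_re hΦs.prod.hasSum).summable
  -- the `Φ` part vanishes (cancellation)
  have hΦzero : ∑' k, (∑' l, Φ (k, l)).re = 0 := by
    rw [← Complex.re_tsum hΦs.prod]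
    exact re_tsum_tsum_latticeConvect_eq_zero (W := W)
      (fun m => IsDivFree.sum_mul_mFourierCoeff_eq_zero hu hdiv m)
      (isConjSymm_mFourierCoeff hu.integrable) hΦsum
  -- ### Young's inequality for the four convolution terms
  -- generic: `∑_k γ_k ∑_l α_l β(k−l) ≤ (∑α) √(∑β²) √(∑γ²)` and the reindexed form
  have hYoung : ∀ {β γ : (d → ℤ) → ℝ}, (∀ m, 0 ≤ β m) → (∀ m, 0 ≤ γ m) → Summable β →
      Summable (fun m => β m ^ 2) → Summable (fun m => γ m ^ 2) → (∀ m, β m ≤ ∑' j, β j) →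
      ∑' k, γ k * ∑' l, ar l * β (k - l) ≤ Fr * Real.sqrt (∑' j, β j ^ 2) *
        Real.sqrt (∑' j, γ j ^ 2) := by
    intro β γ hβ0 hγ0 hβs hβ2s hγ2s hβle
    have hK : ∀ K : Finset (d → ℤ), ∑ k ∈ K, γ k * ∑' l, ar l * β (k - l) ≤
        Fr * Real.sqrt (∑' j, β j ^ 2) * Real.sqrt (∑' j, γ j ^ 2) := by
      intro K
      have hY := NSGevrey.sum_mul_tsum_mul_le K har0 hβ0 hγ0 hars hβ2s
      have h1 : Real.sqrt (∑ k ∈ K, γ k ^ 2) ≤ Real.sqrt (∑' j, γ j ^ 2) :=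
        Real.sqrt_le_sqrt (hγ2s.sum_le_tsum K fun m _ => sq_nonneg _)
      exact hY.trans (mul_le_mul_of_nonneg_left h1 (mul_nonneg hFr0 (Real.sqrt_nonneg _)))
    exact Real.tsum_le_of_sum_le (fun k => mul_nonneg (hγ0 k) (tsum_nonneg fun l =>
      mul_nonneg (har0 l) (hβ0 _))) hK
  have hreidx : ∀ (β : (d → ℤ) → ℝ) (k : d → ℤ),
      ∑' l, β l * ar (k - l) = ∑' l, ar l * β (k - l) := fun β k => by
    rw [← (Equiv.subLeft k).tsum_eq (fun l => β l * ar (k - l))]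
    refine tsum_congr fun l => ?_
    simp only [Equiv.subLeft_apply, sub_sub_cancel]
    ring
  -- fibre sums of `G`
  have hconv : ∀ {β : (d → ℤ) → ℝ}, (∀ m, 0 ≤ β m) → (∀ m, β m ≤ ∑' j, β j) →
      ∀ k, Summable fun l => ar l * β (k - l) := fun {β} hβ0 hβle k =>
    (hars.mul_right (∑' j, β j)).of_nonneg_of_le (fun l => mul_nonneg (har0 l) (hβ0 _))
      fun l => mul_le_mul_of_nonneg_left (hβle _) (har0 l)
  have hconv' : ∀ {β : (d → ℤ) → ℝ}, (∀ m, 0 ≤ β m) → Summable β →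
      ∀ k, Summable fun l => β l * ar (k - l) := fun {β} hβ0 hβs k =>
    (hβs.mul_right Fr).of_nonneg_of_le (fun l => mul_nonneg (hβ0 l) (har0 _))
      fun l => mul_le_mul_of_nonneg_left (hArle _) (hβ0 l)
  have hGk : ∀ k, ∑' l, G (k, l) = C * (2 * (b k * ∑' l, ar l * b'' (k - l)) +
      2 * (b'' k * ∑' l, ar l * b (k - l))) := by
    intro k
    have s1 := hconv hb''0 hB''le k
    have s2 := hconv hb0 hBle k
    have s3 := hconv' hb''0 hb''s k
    have s4 := hconv' hb0 hbs k
    have e : ∀ l, G (k, l) = C * (b k * (ar l * b'' (k - l)) + b'' k * (ar l * b (k - l)) +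
        (b k * (b'' l * ar (k - l)) + b'' k * (b l * ar (k - l)))) := fun l => rfl
    rw [tsum_congr e, tsum_mul_left,
      ((s1.mul_left (b k)).add (s2.mul_left (b'' k))).tsum_add
        ((s3.mul_left (b k)).add (s4.mul_left (b'' k))),
      (s1.mul_left (b k)).tsum_add (s2.mul_left (b'' k)),
      (s3.mul_left (b k)).tsum_add (s4.mul_left (b'' k)),
      tsum_mul_left, tsum_mul_left, tsum_mul_left, tsum_mul_left, hreidx b'' k, hreidx b k]
    ring
  -- summability in `k` of the fibre sums
  have hfib_le : ∀ {β : (d → ℤ) → ℝ}, (∀ m, 0 ≤ β m) → (∀ m, β m ≤ ∑' j, β j) →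
      ∀ k, ∑' l, ar l * β (k - l) ≤ Fr * ∑' j, β j := fun {β} hβ0 hβle k => by
    rw [← tsum_mul_right]
    exact (hconv hβ0 hβle k).tsum_le_tsum (fun l => mul_le_mul_of_nonneg_left (hβle _) (har0 l))
      (hars.mul_right _)
  have hS1s : Summable fun k => b k * ∑' l, ar l * b'' (k - l) :=
    (hbs.mul_right (Fr * ∑' j, b'' j)).of_nonneg_of_le
      (fun k => mul_nonneg (hb0 k) (tsum_nonneg fun l => mul_nonneg (har0 l) (hb''0 _)))
      fun k => mul_le_mul_of_nonneg_left (hfib_le hb''0 hB''le k) (hb0 k)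
  have hS2s : Summable fun k => b'' k * ∑' l, ar l * b (k - l) :=
    (hb''s.mul_right (Fr * ∑' j, b j)).of_nonneg_of_le
      (fun k => mul_nonneg (hb''0 k) (tsum_nonneg fun l => mul_nonneg (har0 l) (hb0 _)))
      fun k => mul_le_mul_of_nonneg_left (hfib_le hb0 hBle k) (hb''0 k)
  have hGsum_le : ∑' k, ∑' l, G (k, l) ≤ 4 * C * Fr * (Real.sqrt X * Real.sqrt X'') := by
    rw [tsum_congr hGk, tsum_mul_left, (hS1s.mul_left 2).tsum_add (hS2s.mul_left 2),
      tsum_mul_left, tsum_mul_left]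
    have t1 := hYoung hb''0 hb0 hb''s hb''2s hb2s hB''le
    have t2 := hYoung hb0 hb''0 hbs hb2s hb''2s hBle
    rw [hXb, hX''b] at t1 t2
    have h4 : 2 * (∑' k, b k * ∑' l, ar l * b'' (k - l)) +
        2 * (∑' k, b'' k * ∑' l, ar l * b (k - l)) ≤ 4 * Fr * (Real.sqrt X * Real.sqrt X'') := by
      nlinarith [t1, t2]
    calc C * (2 * (∑' k, b k * ∑' l, ar l * b'' (k - l)) +
          2 * (∑' k, b'' k * ∑' l, ar l * b (k - l)))
        ≤ C * (4 * Fr * (Real.sqrt X * Real.sqrt X'')) := mul_le_mul_of_nonneg_left h4 hC0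
      _ = 4 * C * Fr * (Real.sqrt X * Real.sqrt X'') := by ring
  -- ### conclusion
  rw [tsum_congr hsplit, hEre_s.tsum_add hΦre_s, hΦzero, add_zero]
  calc |∑' k, (∑' l, E (k, l)).re| ≤ ∑' k, ‖(∑' l, E (k, l)).re‖ := by
        rw [← Real.norm_eq_abs]
        exact norm_tsum_le_tsum_norm hEre_s.norm
    _ ≤ ∑' k, ∑' l, G (k, l) := hEre_s.norm.tsum_le_tsum hEre_le hGs.prod
    _ ≤ 4 * C * Fr * (Real.sqrt X * Real.sqrt X'') := hGsum_le
    _ = 16 * Real.pi * (Fintype.card d : ℝ) * (s * (2 : ℝ) ^ s) * Fr *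
          (Real.sqrt X * Real.sqrt X'') := by
        simp only [hC]
        ring

/-! ### §2 The `Ḣ^{3/2}` energy inequality with the sharp exponents (Cortissoz–Montero) -/

omit [DecidableEq d] in
/-- The zero force has zero Fourier coefficients. [folklore] -/
private theorem mFourierCoeff_complexify_zero_force' (t : ℝ) (k : d → ℤ) :
    mFourierCoeff (EuclideanSpace.complexify ∘
      (0 : ℝ → UnitAddTorus d → EuclideanSpace ℝ d) t) k = 0 := by
  have h : (EuclideanSpace.complexify ∘ (0 : ℝ → UnitAddTorus d → EuclideanSpace ℝ d) t) =
      (0 : UnitAddTorus d → EuclideanSpace ℂ d) := by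
    funext x
    simp
  rw [h, mFourierCoeff_eq_integral_volume]
  simp


/-- **The `Ḣ^{3/2}` energy inequality at the borderline, with the exponents of the generic
range** (Cortissoz–Montero 2015, proof of Thm 2.1 at `s = 3/2`: the energy inequality
`½ d/dt‖u‖²_s + 4π²‖u‖²_{s+1} ≤ C_s (∑_k|û_k||k|^r) ‖u‖_s ‖u‖_{s+1−r}` with `r = ½(s − ½) = ½`,
then `∑_k|k|^{1/2}|û_k| ≤ c ‖u‖_{3/2}^{1/2}‖u‖_{5/2}^{1/2}` (their Hardy–Carlson step; here
Robinson–Sadowski–Silva's Lemma 3.2 with `s₁ = 3/2 < 3/2 + r = 2 < s₂ = 5/2`,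
`Torus.exists_tsum_rpow_mul_norm_le_interpolation`) and `‖u‖_2 ≤ ‖u‖_{3/2}^{1/2}‖u‖_{5/2}^{1/2}`,
giving `½ d/dt‖u‖²_{3/2} + 4π²ν‖u‖²_{5/2} ≤ C ‖u‖²_{3/2} ‖u‖_{5/2}` — the `s = 3/2` instance of
RSS's `C_s‖u‖_s^{s+1/2}‖u‖_{s+1}^{5/2−s}`, which RSS could reach only for `s ≠ 3/2`). For
`card d = 3` and `s = 3/2` there is `K ≥ 0` such that along every classical mean-zero solution of
the unforced equations (`ν > 0`) on `[a, b] × T³`, at interior times,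
`X' ≤ −8π²ν Z + K (√X)^{s+1/2} (√Z)^{5/2−s}`, `X = ∑|k|^{2s}‖û‖²`, `Z = ∑|k|^{2s+2}‖û‖²` — the
shape of `NSSobolev.hsSeminorm_sq_deriv_le'` without its exclusion `s ≠ 3/2`.
[cite: CortissozMontero2015, §2 Thm 2.1 (proof, (2.2)–(2.3)), Lemma 2.1;
RobinsonSadowskiSilva2012, Lemma 3.2, §IV] -/
theorem hsSeminorm_sq_deriv_le_of_eq_three_halves (hd : Fintype.card d = 3) {s : ℝ}
    (hs3 : s = 3 / 2) :
    ∃ K : ℝ, 0 ≤ K ∧ ∀ {ν a b : ℝ}, 0 < ν → a < b →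
      ∀ {u : ℝ → UnitAddTorus d → EuclideanSpace ℝ d} {p : ℝ → UnitAddTorus d → ℝ},
      Torus.IsClassicalNSSolutionOn (Icc a b) ν 0 u p → (∀ t ∈ Icc a b, HasZeroMean (u t)) →
      ∀ t ∈ Ioo a b, ∃ D : ℝ,
        HasDerivAt (fun τ => ∑' k : d → ℤ,
          freqNormSq k ^ s * ‖mFourierCoeff (EuclideanSpace.complexify ∘ u τ) k‖ ^ 2) D t ∧
        D ≤ -(8 * Real.pi ^ 2 * ν) *
              (∑' k : d → ℤ, freqNormSq k ^ (s + 1) *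
                ‖mFourierCoeff (EuclideanSpace.complexify ∘ u t) k‖ ^ 2) +
            K * Real.sqrt (∑' k : d → ℤ, freqNormSq k ^ s *
                  ‖mFourierCoeff (EuclideanSpace.complexify ∘ u t) k‖ ^ 2) ^ (s + 1 / 2) *
              Real.sqrt (∑' k : d → ℤ, freqNormSq k ^ (s + 1) *
                  ‖mFourierCoeff (EuclideanSpace.complexify ∘ u t) k‖ ^ 2) ^ (5 / 2 - s) := by
  classical
  have hn : (Fintype.card d : ℝ) = 3 := by rw [hd]; norm_num
  obtain ⟨CI, hCI0, hCI⟩ := exists_tsum_rpow_mul_norm_le_interpolation (d := d) (r := 1 / 2)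
    (s₁ := s) (s₂ := s + 1) (by rw [hn, hs3]; norm_num) (by rw [hn, hs3]; norm_num)
  set C₆ : ℝ := 16 * Real.pi * (Fintype.card d : ℝ) * (s * (2 : ℝ) ^ s) with hC₆
  have hs0 : (0 : ℝ) ≤ s := by rw [hs3]; norm_num
  have hC₆0 : 0 ≤ C₆ := by rw [hC₆]; positivity
  refine ⟨2 * C₆ * CI, by positivity, fun {ν a b} hν hab {u p} h hmean t ht => ?_⟩
  have hU : UniqueDiffOn ℝ (Icc a b) := uniqueDiffOn_Icc hab
  have htS : t ∈ Icc a b := Ioo_subset_Icc_self ht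
  have hut : IsSmooth (u t) := h.smooth_velocity.isSmooth_slice htS
  refine ⟨_, hasDerivAt_tsum_rpow_mul_norm_sq hab h.smooth_velocity (by rw [hs3]; norm_num)
    (by rw [hn, hs3]; norm_num) ht, ?_⟩
  -- notation
  set c : (d → ℤ) → EuclideanSpace ℂ d := fun k => mFourierCoeff (EuclideanSpace.complexify ∘ u t) k
    with hc
  set wt : (d → ℤ) → EuclideanSpace ℂ d :=
    fun k => mFourierCoeff (EuclideanSpace.complexify ∘ timeDerivWithin (Icc a b) u t) k with hwt
  set B : (d → ℤ) → EuclideanSpace ℂ d :=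
    fun k => mFourierCoeff (EuclideanSpace.complexify ∘ Torus.convect (u t) (u t)) k with hB
  set X : ℝ := ∑' k, freqNormSq k ^ s * ‖c k‖ ^ 2 with hX
  set Z : ℝ := ∑' k, freqNormSq k ^ (s + 1) * ‖c k‖ ^ 2 with hZ
  set X₂ : ℝ := ∑' k, freqNormSq k ^ (s + 1 - 1 / 2) * ‖c k‖ ^ 2 with hX₂
  set Fr : ℝ := ∑' k, freqNormSq k ^ ((1 / 2 : ℝ) / 2) * ‖c k‖ with hFr
  have hw0 : ∀ (r : ℝ) k, 0 ≤ freqNormSq k ^ r * ‖c k‖ ^ 2 := fun r k =>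
    mul_nonneg (Real.rpow_nonneg (freqNormSq_nonneg k) _) (sq_nonneg _)
  have hsumX : Summable fun k => freqNormSq k ^ s * ‖c k‖ ^ 2 :=
    hut.summable_freqNormSq_rpow_mul_norm_sq hs0
  have hsumZ : Summable fun k => freqNormSq k ^ (s + 1) * ‖c k‖ ^ 2 :=
    hut.summable_freqNormSq_rpow_mul_norm_sq (by linarith)
  have hX0 : 0 ≤ X := tsum_nonneg (hw0 s)
  have hZ0 : 0 ≤ Z := tsum_nonneg (hw0 (s + 1))
  have hX₂0 : 0 ≤ X₂ := tsum_nonneg (hw0 _)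
  have hFr0 : 0 ≤ Fr := tsum_nonneg fun k =>
    mul_nonneg (Real.rpow_nonneg (freqNormSq_nonneg k) _) (norm_nonneg _)
  set x : ℝ := Real.sqrt X with hx
  set z : ℝ := Real.sqrt Z with hz
  have hx0 : 0 ≤ x := Real.sqrt_nonneg _
  have hz0 : 0 ≤ z := Real.sqrt_nonneg _
  show ∑' k, freqNormSq k ^ s * (2 * (inner ℂ (wt k) (c k)).re) ≤
    -(8 * Real.pi ^ 2 * ν) * Z + 2 * C₆ * CI * x ^ (s + 1 / 2) * z ^ (5 / 2 - s)
  -- ### the modewise energy identity (pressure invisible, zero force)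
  have hid : ∀ k, (inner ℂ (wt k) (c k)).re =
      -(ν * (4 * Real.pi ^ 2 * freqNormSq k)) * ‖c k‖ ^ 2 - (inner ℂ (B k) (c k)).re := by
    intro k
    have h1 := h.re_inner_mFourierCoeff_timeDerivWithin hU htS k
    rw [mFourierCoeff_complexify_zero_force', inner_zero_left, Complex.zero_re, add_zero] at h1
    exact h1
  -- ### Lemma 2.1 at `r = 1/2`: `|∑ Qk| ≤ C₆ Fr √X √X₂`
  set Qk : (d → ℤ) → ℝ := fun k => freqNormSq k ^ s * (inner ℂ (B k) (c k)).re with hQ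
  have h21 : |∑' k, Qk k| ≤ C₆ * Fr * (x * Real.sqrt X₂) :=
    abs_tsum_rpow_mul_re_inner_convect_le_of_rpow hut (h.divFree t htS) (by rw [hs3]; norm_num)
      (by norm_num : (0 : ℝ) ≤ 1 / 2) (by norm_num : (1 / 2 : ℝ) ≤ 1)
  -- summability of `Qk` (termwise bound by `|k|^{2s}‖B̂(k)‖‖û(k)‖`, summable by (3.5))
  have hQs : Summable Qk := by
    set Rk : (d → ℤ) → ℝ := fun k => freqNormSq k ^ s * ‖c k‖ * ‖B k‖ with hR
    have hR0 : ∀ k, 0 ≤ Rk k := fun k =>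
      mul_nonneg (mul_nonneg (Real.rpow_nonneg (freqNormSq_nonneg k) _) (norm_nonneg _))
        (norm_nonneg _)
    set CT : ℝ := 4 * Real.pi * (Fintype.card d : ℝ) ^ 2 * (2 : ℝ) ^ s with hCT
    have hCT0 : 0 ≤ CT := by rw [hCT]; positivity
    set F : ℝ := ∑' k, ‖c k‖ with hF
    have hF0 : 0 ≤ F := tsum_nonneg fun k => norm_nonneg _
    have hRK : ∀ K : Finset (d → ℤ), ∑ k ∈ K, Rk k ≤ CT * F * Real.sqrt X * Real.sqrt Z := by
      intro K
      have h1 := sum_rpow_mul_norm_mul_norm_convect_le hut (h.divFree t htS) hs0 K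
      refine h1.trans ?_
      have h2 : Real.sqrt (∑ k ∈ K, freqNormSq k ^ (s + 1) * ‖c k‖ ^ 2) ≤ Real.sqrt Z :=
        Real.sqrt_le_sqrt (sum_le_hasSum K (fun k _ => hw0 (s + 1) k) hsumZ.hasSum)
      exact mul_le_mul_of_nonneg_left h2 (mul_nonneg (mul_nonneg hCT0 hF0) (Real.sqrt_nonneg _))
    have hRs : Summable Rk := summable_of_sum_le hR0 hRK
    have hQle : ∀ k, |Qk k| ≤ Rk k := fun k => by
      simp only [hQ, hR, abs_mul, abs_of_nonneg (Real.rpow_nonneg (freqNormSq_nonneg k) s),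
        mul_assoc]
      exact mul_le_mul_of_nonneg_left
        ((Complex.abs_re_le_norm _).trans ((norm_inner_le_norm (B k) (c k)).trans
          (le_of_eq (mul_comm _ _))))
        (Real.rpow_nonneg (freqNormSq_nonneg k) s)
    exact Summable.of_norm_bounded hRs fun k => (Real.norm_eq_abs _).le.trans (hQle k)
  -- ### `F_{1/2} ≤ C_I x^{1/2} z^{1/2}` (Lemma 3.2, `s₁ = s`, `s₂ = s + 1`, `r = 1/2`)
  have hFrle : Fr ≤ CI * x ^ (1 / 2 : ℝ) * z ^ (1 / 2 : ℝ) := by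
    obtain ⟨-, hle⟩ := hCI (u t) (hut.memLp 2) (hmean t htS) hsumZ
    have e1 : (s + 1 - 1 / 2 - (Fintype.card d : ℝ) / 2) / (s + 1 - s) = 1 / 2 := by
      rw [hn, hs3]; norm_num
    have e2 : ((Fintype.card d : ℝ) / 2 + 1 / 2 - s) / (s + 1 - s) = 1 / 2 := by
      rw [hn, hs3]; norm_num
    rw [e1, e2] at hle
    exact hle
  -- ### `X₂ ≤ X^{1/2} Z^{1/2}`, hence `√X₂ ≤ √x √z`
  have hX₂le : Real.sqrt X₂ ≤ Real.sqrt x * Real.sqrt z := by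
    have hint := (tsum_rpow_mul_le_interpolate (a := fun k => ‖c k‖ ^ 2) (fun k => sq_nonneg _)
      (s₁ := s) (s₂ := s + 1) (θ := 1 / 2) hs0 (by linarith) (by norm_num) (by norm_num)
      hsumX hsumZ).2
    have e : (1 / 2 : ℝ) * s + (1 - 1 / 2) * (s + 1) = s + 1 - 1 / 2 := by ring
    rw [e] at hint
    have h2 : X ^ (1 / 2 : ℝ) * Z ^ (1 - 1 / 2 : ℝ) = x * z := by
      rw [show (1 - 1 / 2 : ℝ) = 1 / 2 by norm_num, hx, hz, Real.sqrt_eq_rpow, Real.sqrt_eq_rpow]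
    rw [h2] at hint
    rw [← Real.sqrt_mul hx0]
    exact Real.sqrt_le_sqrt hint
  -- ### assemble: `Fr · x · √X₂ ≤ C_I x² z`
  have hprod : Fr * (x * Real.sqrt X₂) ≤ CI * (x ^ 2 * z) := by
    have hsx : x ^ (1 / 2 : ℝ) = Real.sqrt x := (Real.sqrt_eq_rpow x).symm
    have hsz : z ^ (1 / 2 : ℝ) = Real.sqrt z := (Real.sqrt_eq_rpow z).symm
    rw [hsx, hsz] at hFrle
    have h1 : Fr * (x * Real.sqrt X₂) ≤ (CI * Real.sqrt x * Real.sqrt z) * (x * (Real.sqrt x *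
        Real.sqrt z)) :=
      mul_le_mul hFrle (mul_le_mul_of_nonneg_left hX₂le hx0) (mul_nonneg hx0 (Real.sqrt_nonneg _))
        (by positivity)
    refine h1.trans (le_of_eq ?_)
    have ex : Real.sqrt x * Real.sqrt x = x := Real.mul_self_sqrt hx0
    have ez : Real.sqrt z * Real.sqrt z = z := Real.mul_self_sqrt hz0
    calc CI * Real.sqrt x * Real.sqrt z * (x * (Real.sqrt x * Real.sqrt z))
        = CI * (x * (Real.sqrt x * Real.sqrt x) * (Real.sqrt z * Real.sqrt z)) := by ring
      _ = CI * (x ^ 2 * z) := by rw [ex, ez]; ring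
  -- ### split the derivative: `D = −8π²ν Z − 2 ∑ Qk`
  have hterm : ∀ k, freqNormSq k ^ s * (2 * (inner ℂ (wt k) (c k)).re) =
      -(8 * Real.pi ^ 2 * ν) * (freqNormSq k ^ (s + 1) * ‖c k‖ ^ 2) - 2 * Qk k := by
    intro k
    rw [hid k]
    simp only [hQ]
    have e : freqNormSq k ^ (s + 1) = freqNormSq k ^ s * freqNormSq k := by
      rw [Real.rpow_add' (freqNormSq_nonneg k) (by linarith : s + 1 ≠ 0), Real.rpow_one]
    rw [e]
    ring
  have hD : ∑' k, freqNormSq k ^ s * (2 * (inner ℂ (wt k) (c k)).re) =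
      -(8 * Real.pi ^ 2 * ν) * Z - 2 * ∑' k, Qk k := by
    rw [tsum_congr hterm, (hsumZ.mul_left _).tsum_sub (hQs.mul_left 2), tsum_mul_left,
      tsum_mul_left]
  rw [hD]
  have hexp : x ^ (s + 1 / 2) * z ^ (5 / 2 - s) = x ^ 2 * z := by
    rw [hs3, show (3 / 2 + 1 / 2 : ℝ) = 2 by norm_num, show (5 / 2 - 3 / 2 : ℝ) = 1 by norm_num,
      Real.rpow_two, Real.rpow_one]
  have hfin : -(2 : ℝ) * ∑' k, Qk k ≤ 2 * C₆ * CI * (x ^ 2 * z) := by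
    calc -(2 : ℝ) * ∑' k, Qk k ≤ 2 * |∑' k, Qk k| := by linarith [neg_abs_le (∑' k, Qk k)]
      _ ≤ 2 * (C₆ * Fr * (x * Real.sqrt X₂)) := by linarith [h21]
      _ = 2 * C₆ * (Fr * (x * Real.sqrt X₂)) := by ring
      _ ≤ 2 * C₆ * (CI * (x ^ 2 * z)) := mul_le_mul_of_nonneg_left hprod (by positivity)
      _ = 2 * C₆ * CI * (x ^ 2 * z) := by ring
  calc -(8 * Real.pi ^ 2 * ν) * Z - 2 * ∑' k, Qk k
      ≤ -(8 * Real.pi ^ 2 * ν) * Z + 2 * C₆ * CI * (x ^ 2 * z) := by linarith [hfin]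
    _ = -(8 * Real.pi ^ 2 * ν) * Z + 2 * C₆ * CI * x ^ (s + 1 / 2) * z ^ (5 / 2 - s) := by
        rw [mul_assoc (2 * C₆ * CI), hexp]

/-- **The `Ḣ^s` energy inequality on the WHOLE range `1/2 < s < 5/2`** (Robinson–Sadowski–Silva
2012 §IV for `s ≠ 3/2`, `NSSobolev.hsSeminorm_sq_deriv_le'`; Cortissoz–Montero 2015 Thm 2.1 for
the borderline `s = 3/2`, `NSSobolev.hsSeminorm_sq_deriv_le_of_eq_three_halves`): there is
`K = K(s) ≥ 0` with `X' ≤ −8π²ν Z + K (√X)^{s+1/2} (√Z)^{5/2−s}` along every classical mean-zero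
solution on `T³`. [cite: CortissozMontero2015, §2 Thm 2.1; RobinsonSadowskiSilva2012, §IV] -/
theorem hsSeminorm_sq_deriv_le'' (hd : Fintype.card d = 3) {s : ℝ} (hs : 1 / 2 < s)
    (hs' : s < 5 / 2) :
    ∃ K : ℝ, 0 ≤ K ∧ ∀ {ν a b : ℝ}, 0 < ν → a < b →
      ∀ {u : ℝ → UnitAddTorus d → EuclideanSpace ℝ d} {p : ℝ → UnitAddTorus d → ℝ},
      Torus.IsClassicalNSSolutionOn (Icc a b) ν 0 u p → (∀ t ∈ Icc a b, HasZeroMean (u t)) →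
      ∀ t ∈ Ioo a b, ∃ D : ℝ,
        HasDerivAt (fun τ => ∑' k : d → ℤ,
          freqNormSq k ^ s * ‖mFourierCoeff (EuclideanSpace.complexify ∘ u τ) k‖ ^ 2) D t ∧
        D ≤ -(8 * Real.pi ^ 2 * ν) *
              (∑' k : d → ℤ, freqNormSq k ^ (s + 1) *
                ‖mFourierCoeff (EuclideanSpace.complexify ∘ u t) k‖ ^ 2) +
            K * Real.sqrt (∑' k : d → ℤ, freqNormSq k ^ s *
                  ‖mFourierCoeff (EuclideanSpace.complexify ∘ u t) k‖ ^ 2) ^ (s + 1 / 2) *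
              Real.sqrt (∑' k : d → ℤ, freqNormSq k ^ (s + 1) *
                  ‖mFourierCoeff (EuclideanSpace.complexify ∘ u t) k‖ ^ 2) ^ (5 / 2 - s) := by
  by_cases hs3 : s = 3 / 2
  · exact hsSeminorm_sq_deriv_le_of_eq_three_halves hd hs3
  · exact hsSeminorm_sq_deriv_le' hd hs hs' hs3

/-! ### §3 Young's inequality: the growth-rate law on the whole range -/

/-- **The `Ḣ^s` growth-rate law on the WHOLE range `1/2 < s < 5/2`, borderline included**
(Robinson–Sadowski–Silva 2012, §IV: "Application of Young's inequality on the right-hand side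
yields `d/dt ‖u‖_s² ≤ c_s ‖u‖_s^{2(2s+1)/(2s−1)}`"; at `s = 3/2` Cortissoz–Montero 2015, proof of
Thm 2.1: "`½ d/dt(‖u(t)‖_s²) ≤ c_s(‖u(t)‖_s²)^{1+1/(s−1/2)}`", i.e. `X' ≤ c X²`): for `card d = 3`
and `1/2 < s < 5/2` there is `c = c(s) ≥ 0` such that for every `ν > 0`, every classical solution
with mean-zero slices on `[a, b] × T³` and every `t ∈ (a, b)`, `X(τ) = ∑_k |k|^{2s}‖û(τ,k)‖²` is
differentiable at `t` and
`X'(t) ≤ −4π²ν ∑_k |k|^{2s+2}‖û(t,k)‖² + c ν^{−(5−2s)/(2s−1)} X(t)^{(2s+1)/(2s−1)}`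
(the proof of `NSSobolev.hsSeminorm_sq_deriv_le_rpow'` verbatim, fed with
`NSSobolev.hsSeminorm_sq_deriv_le''`; at `s = 3/2` the exponent is `2` and the power of `ν` is
`−1`). [cite: CortissozMontero2015, §2 Thm 2.1 (proof); RobinsonSadowskiSilva2012, §IV] -/
theorem hsSeminorm_sq_deriv_le_rpow'' (hd : Fintype.card d = 3) {s : ℝ} (hs : 1 / 2 < s)
    (hs' : s < 5 / 2) :
    ∃ c : ℝ, 0 ≤ c ∧ ∀ {ν a b : ℝ}, 0 < ν → a < b →
      ∀ {u : ℝ → UnitAddTorus d → EuclideanSpace ℝ d} {p : ℝ → UnitAddTorus d → ℝ},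
      Torus.IsClassicalNSSolutionOn (Icc a b) ν 0 u p → (∀ t ∈ Icc a b, HasZeroMean (u t)) →
      ∀ t ∈ Ioo a b, ∃ D : ℝ,
        HasDerivAt (fun τ => ∑' k : d → ℤ,
          freqNormSq k ^ s * ‖mFourierCoeff (EuclideanSpace.complexify ∘ u τ) k‖ ^ 2) D t ∧
        D ≤ -(4 * Real.pi ^ 2 * ν) *
              (∑' k : d → ℤ, freqNormSq k ^ (s + 1) *
                ‖mFourierCoeff (EuclideanSpace.complexify ∘ u t) k‖ ^ 2) +
            c * ν ^ (-((5 - 2 * s) / (2 * s - 1))) *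
              (∑' k : d → ℤ, freqNormSq k ^ s *
                ‖mFourierCoeff (EuclideanSpace.complexify ∘ u t) k‖ ^ 2) ^
                  ((2 * s + 1) / (2 * s - 1)) := by
  classical
  obtain ⟨K, hK0, hK⟩ := hsSeminorm_sq_deriv_le'' hd hs hs'
  set θ : ℝ := (5 - 2 * s) / 4 with hθ
  have hθ0 : 0 < θ := by rw [hθ]; linarith
  have hθ1 : θ < 1 := by rw [hθ]; linarith
  have h1θ : 1 - θ = (2 * s - 1) / 4 := by rw [hθ]; ring
  have h1θ0 : 0 < 1 - θ := by linarith
  have hs1 : (0 : ℝ) < 2 * s - 1 := by linarith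
  set c : ℝ := (K * (4 * Real.pi ^ 2) ^ (-θ)) ^ (1 / (1 - θ)) with hc
  have hc0 : 0 ≤ c := Real.rpow_nonneg (mul_nonneg hK0 (Real.rpow_nonneg (by positivity) _)) _
  refine ⟨c, hc0, fun {ν a b} hν hab {u p} h hmean t ht => ?_⟩
  obtain ⟨D, hD, hle⟩ := hK hν hab h hmean t ht
  refine ⟨D, hD, hle.trans ?_⟩
  set X : ℝ := ∑' k : d → ℤ, freqNormSq k ^ s *
    ‖mFourierCoeff (EuclideanSpace.complexify ∘ u t) k‖ ^ 2 with hX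
  set Z : ℝ := ∑' k : d → ℤ, freqNormSq k ^ (s + 1) *
    ‖mFourierCoeff (EuclideanSpace.complexify ∘ u t) k‖ ^ 2 with hZ
  have hw0 : ∀ (r : ℝ) (k : d → ℤ), 0 ≤ freqNormSq k ^ r *
      ‖mFourierCoeff (EuclideanSpace.complexify ∘ u t) k‖ ^ 2 := fun r k =>
    mul_nonneg (Real.rpow_nonneg (freqNormSq_nonneg k) _) (sq_nonneg _)
  have hX0 : 0 ≤ X := tsum_nonneg (hw0 s)
  have hZ0 : 0 ≤ Z := tsum_nonneg (hw0 (s + 1))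
  set L : ℝ := 4 * Real.pi ^ 2 * ν with hL
  have hL0 : 0 < L := by rw [hL]; positivity
  have hLθ : 0 < L ^ θ := Real.rpow_pos_of_pos hL0 θ
  set β : ℝ := (2 * s + 1) / (2 * s - 1) with hβ
  have hKL0 : 0 ≤ K * L ^ (-θ) := mul_nonneg hK0 (Real.rpow_nonneg hL0.le _)
  set M : ℝ := (K * L ^ (-θ)) ^ (1 / (1 - θ)) * X ^ β with hM
  have hM0 : 0 ≤ M := mul_nonneg (Real.rpow_nonneg hKL0 _) (Real.rpow_nonneg hX0 _)
  have hAMGM := Real.geom_mean_le_arith_mean2_weighted hθ0.le h1θ0.le (mul_nonneg hL0.le hZ0) hM0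
    (by ring : θ + (1 - θ) = 1)
  -- the exponents
  have e3 : 1 / (1 - θ) * (1 - θ) = 1 := by rw [one_div, inv_mul_cancel₀ h1θ0.ne']
  have e4 : β * (1 - θ) = (2 * s + 1) / 4 := by
    rw [hβ, h1θ, div_mul_div_comm, div_eq_div_iff (by positivity) (by norm_num)]
    ring
  have hsX : Real.sqrt X ^ (s + 1 / 2) = X ^ ((2 * s + 1) / 4) := by
    rw [Real.sqrt_eq_rpow, ← Real.rpow_mul hX0]
    congr 1
    ring
  have hsZ : Real.sqrt Z ^ (5 / 2 - s) = Z ^ θ := by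
    rw [Real.sqrt_eq_rpow, ← Real.rpow_mul hZ0, hθ]
    congr 1
    ring
  -- `K X^{(2s+1)/4} Z^θ = (L Z)^θ · M^{1−θ}`
  have hid : (L * Z) ^ θ * M ^ (1 - θ) = K * X ^ ((2 * s + 1) / 4) * Z ^ θ := by
    rw [hM, Real.mul_rpow hL0.le hZ0,
      Real.mul_rpow (Real.rpow_nonneg hKL0 _) (Real.rpow_nonneg hX0 _), ← Real.rpow_mul hKL0,
      ← Real.rpow_mul hX0, e3, Real.rpow_one, e4, Real.rpow_neg hL0.le]
    calc L ^ θ * Z ^ θ * (K * (L ^ θ)⁻¹ * X ^ ((2 * s + 1) / 4))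
        = K * X ^ ((2 * s + 1) / 4) * Z ^ θ * (L ^ θ * (L ^ θ)⁻¹) := by ring
      _ = K * X ^ ((2 * s + 1) / 4) * Z ^ θ := by rw [mul_inv_cancel₀ hLθ.ne', mul_one]
  -- `M = c ν^{−(5−2s)/(2s−1)} X^β`
  have hs1' : 2 * s - 1 ≠ 0 := hs1.ne'
  have e5 : -θ * (1 / (1 - θ)) = -((5 - 2 * s) / (2 * s - 1)) := by
    rw [h1θ, hθ]
    field_simp
  have hMc : M = c * ν ^ (-((5 - 2 * s) / (2 * s - 1))) * X ^ β := by
    rw [hM, hc, hL, Real.mul_rpow (by positivity : (0 : ℝ) ≤ 4 * Real.pi ^ 2) hν.le, ← mul_assoc,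
      Real.mul_rpow (mul_nonneg hK0 (Real.rpow_nonneg (by positivity) _))
        (Real.rpow_nonneg hν.le _),
      ← Real.rpow_mul hν.le, e5]
  calc -(8 * Real.pi ^ 2 * ν) * Z + K * Real.sqrt X ^ (s + 1 / 2) * Real.sqrt Z ^ (5 / 2 - s)
      = -(8 * Real.pi ^ 2 * ν) * Z + (L * Z) ^ θ * M ^ (1 - θ) := by rw [hsX, hsZ, hid]
    _ ≤ -(8 * Real.pi ^ 2 * ν) * Z + (θ * (L * Z) + (1 - θ) * M) := by linarith [hAMGM]
    _ ≤ -(8 * Real.pi ^ 2 * ν) * Z + (L * Z + M) := by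
        nlinarith [mul_nonneg hL0.le hZ0, hM0, hθ0, h1θ0]
    _ = -(4 * Real.pi ^ 2 * ν) * Z + c * ν ^ (-((5 - 2 * s) / (2 * s - 1))) * X ^ β := by
        rw [hMc, hL]
        ring

/-! ### §4 Lifespan, window bound and blow-up rate on the whole range `1/2 < s < 5/2`
(the proofs of `TorusNSSobolevLifespan` verbatim, fed with the borderline-inclusive law) -/

/-- Comparison for `X' ≤ κ X^β` (`β > 1`, `X ≥ 0` continuous on `[a, b]`, differentiable inside),
regularised form: for every `δ > 0` and `t ∈ [a, b]`,
`(X(a) + δ)^{1−β} ≤ (X(t) + δ)^{1−β} + (β − 1) κ (t − a)`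
(the function `(X + δ)^{1−β} + (β−1)κ t` is non-decreasing; Robinson–Sadowski–Silva (4.1)).
[folklore] -/
private theorem rpow_add_le_of_deriv_le {X X' : ℝ → ℝ} {a b κ β : ℝ} (hab : a < b) (hκ : 0 ≤ κ)
    (hβ : 1 < β) (hX0 : ∀ t ∈ Icc a b, 0 ≤ X t) (hXc : ContinuousOn X (Icc a b))
    (hXd : ∀ t ∈ Ioo a b, HasDerivAt X (X' t) t) (hX' : ∀ t ∈ Ioo a b, X' t ≤ κ * X t ^ β)
    {δ : ℝ} (hδ : 0 < δ) {t : ℝ} (ht : t ∈ Icc a b) :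
    (X a + δ) ^ (1 - β) ≤ (X t + δ) ^ (1 - β) + (β - 1) * κ * (t - a) := by
  set φ : ℝ → ℝ := fun τ => (X τ + δ) ^ (1 - β) + (β - 1) * κ * τ with hφ
  have hpos : ∀ τ ∈ Icc a b, 0 < X τ + δ := fun τ hτ => by linarith [hX0 τ hτ]
  have hφc : ContinuousOn φ (Icc a b) :=
    ((hXc.add continuousOn_const).rpow_const fun τ hτ => Or.inl (hpos τ hτ).ne').add
      (continuousOn_const.mul continuousOn_id)
  have hφd : ∀ τ ∈ Ioo a b, HasDerivAt φ
      (X' τ * (1 - β) * (X τ + δ) ^ (1 - β - 1) + (β - 1) * κ * 1) τ := fun τ hτ =>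
    (((hXd τ hτ).add_const δ).rpow_const (Or.inl (hpos τ (Ioo_subset_Icc_self hτ)).ne')).add
      ((hasDerivAt_id τ).const_mul ((β - 1) * κ))
  have hφ' : ∀ τ ∈ Ioo a b, 0 ≤ X' τ * (1 - β) * (X τ + δ) ^ (1 - β - 1) + (β - 1) * κ * 1 := by
    intro τ hτ
    have hτ' := Ioo_subset_Icc_self hτ
    have hXτ := hX0 τ hτ'
    have hp := hpos τ hτ'
    rw [show (1 : ℝ) - β - 1 = -β by ring]
    -- `X'(X+δ)^{-β} ≤ κ X^β (X+δ)^{-β} ≤ κ`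
    have h1 : X' τ * (X τ + δ) ^ (-β) ≤ κ := by
      have hb : X τ ^ β ≤ (X τ + δ) ^ β := Real.rpow_le_rpow hXτ (by linarith) (by linarith)
      calc X' τ * (X τ + δ) ^ (-β) ≤ κ * X τ ^ β * (X τ + δ) ^ (-β) :=
            mul_le_mul_of_nonneg_right (hX' τ hτ) (Real.rpow_nonneg hp.le _)
        _ ≤ κ * (X τ + δ) ^ β * (X τ + δ) ^ (-β) :=
            mul_le_mul_of_nonneg_right (mul_le_mul_of_nonneg_left hb hκ) (Real.rpow_nonneg hp.le _)
        _ = κ := by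
            rw [mul_assoc, ← Real.rpow_add hp, add_neg_cancel, Real.rpow_zero, mul_one]
    nlinarith [h1]
  have hmono : MonotoneOn φ (Icc a b) := by
    refine monotoneOn_of_deriv_nonneg (convex_Icc a b) hφc ?_ ?_
    · rw [interior_Icc]
      exact fun τ hτ => (hφd τ hτ).differentiableAt.differentiableWithinAt
    · rw [interior_Icc]
      intro τ hτ
      rw [(hφd τ hτ).deriv]
      exact hφ' τ hτ
  have h := hmono (left_mem_Icc.2 hab.le) ht ht.1
  simp only [hφ] at h
  linarith

/-- (WHOLE range `1/2 < s < 5/2`, the borderline `s = 3/2` INCLUDED — Cortissoz–Montero 2015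
Thm 2.1 / Cor 2.1 supply the law at `s = 3/2` (`NSSobolev.hsSeminorm_sq_deriv_le_rpow''`); the
proof below is that of the `s ≠ 3/2` version in `TorusNSSobolevLifespan`, verbatim, fed with the
borderline-inclusive law; the continuation step uses the level `min s 1`.)
**The `Ḣ^s` norm controls its own lifespan** (Robinson–Sadowski–Silva 2012: the law
`d/dt‖u‖_s² ≤ c_s‖u‖_s^{2(2s+1)/(2s−1)}` shows "that the local existence time depends only on the
norm in `Ḣ^s`", time `≳ ‖u₀‖_{Ḣ^s}^{−4/(2s−1)}` by the scaling of §II; Cortissoz–Montero Cor. 2.1: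
"`K_s/(‖u₀‖_s)^{4/(2s−1)} ≤ T`", now for ALL `1/2 < s < 5/2`), continuation form for classical
solutions on `T³` with the viscosity explicit: for `card d = 3` and `1/2 < s < 5/2` there is
`c₀ = c₀(s) > 0` such that a classical mean-zero solution on `[0, T) × T³` (zero force) with
`T · (‖u(0)‖²_{Ḣ^s})^{2/(2s−1)} ≤ c₀ ν^{(5−2s)/(2s−1)}` (`‖u‖²_{Ḣ^s} = ∑_k |k|^{2s}‖û(k)‖²`)
satisfies `‖u(t)‖²_{Ḣ^s} ≤ 2^{(2s−1)/2} ‖u(0)‖²_{Ḣ^s}` on `[0, T)` and extends to a classical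
mean-zero solution on a strictly longer closed interval; at `s = 3/2`: no blow-up before
`c₀ ν ‖u(0)‖_{Ḣ^{3/2}}^{−2}`.
[cite: CortissozMontero2015, §2 Cor 2.1 (arXiv p. 5);
RobinsonSadowskiSilva2012, §IV with §II (2.2)] -/
theorem classicalNS_continuation_of_hsSeminorm_lifespan'' (hd : Fintype.card d = 3) {s : ℝ}
    (hs : 1 / 2 < s) (hs' : s < 5 / 2) :
    ∃ c₀ : ℝ, 0 < c₀ ∧ ∀ {ν T : ℝ}, 0 < ν → 0 < T →
      ∀ {u : ℝ → UnitAddTorus d → EuclideanSpace ℝ d} {p : ℝ → UnitAddTorus d → ℝ},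
      Torus.IsClassicalNSSolutionOn (Ico 0 T) ν 0 u p → (∀ t ∈ Ico 0 T, HasZeroMean (u t)) →
      T * (∑' k : d → ℤ, freqNormSq k ^ s *
          ‖mFourierCoeff (EuclideanSpace.complexify ∘ u 0) k‖ ^ 2) ^ (2 / (2 * s - 1)) ≤
        c₀ * ν ^ ((5 - 2 * s) / (2 * s - 1)) →
      (∀ t ∈ Ico 0 T, (∑' k : d → ℤ, freqNormSq k ^ s *
          ‖mFourierCoeff (EuclideanSpace.complexify ∘ u t) k‖ ^ 2) ≤
        (2 : ℝ) ^ ((2 * s - 1) / 2) * ∑' k : d → ℤ, freqNormSq k ^ s *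
          ‖mFourierCoeff (EuclideanSpace.complexify ∘ u 0) k‖ ^ 2) ∧
      ∃ T' : ℝ, T < T' ∧ ∃ (u' : ℝ → UnitAddTorus d → EuclideanSpace ℝ d)
        (p' : ℝ → UnitAddTorus d → ℝ), Torus.IsClassicalNSSolutionOn (Icc 0 T') ν 0 u' p' ∧
          (∀ t ∈ Icc 0 T', HasZeroMean (u' t)) ∧ ∀ t ∈ Ico 0 T, u' t = u t := by
  classical
  have hn : (Fintype.card d : ℝ) = 3 := by rw [hd]; norm_num
  obtain ⟨c, hc0, hc⟩ := hsSeminorm_sq_deriv_le_rpow'' hd hs hs'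
  -- the Sobolev level used for the continuation step: `s₀ = min s 1 ∈ (1/2, 3/2)`, `s₀ ≤ s`
  set s₀ : ℝ := min s 1 with hs₀
  have hs₀0 : 1 / 2 < s₀ := lt_min hs (by norm_num)
  have hs₀1 : s₀ ≤ 1 := min_le_right _ _
  have hs₀s : s₀ ≤ s := min_le_left _ _
  obtain ⟨CE, hCE0, hCE⟩ := exists_rpow_integral_rpow_norm_le_hsSeminorm (d := d) (s := s₀)
    (by linarith) (by rw [hn]; linarith)
  -- exponents
  set γ : ℝ := 2 / (2 * s - 1) with hγ
  set β : ℝ := (2 * s + 1) / (2 * s - 1) with hβ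
  set α : ℝ := (5 - 2 * s) / (2 * s - 1) with hα
  have hs1 : (0 : ℝ) < 2 * s - 1 := by linarith
  have hγ0 : 0 < γ := by rw [hγ]; positivity
  have hβγ : β = 1 + γ := by rw [hβ, hγ]; field_simp; ring
  have hβ1 : 1 < β := by rw [hβγ]; linarith
  set c₀ : ℝ := 1 / (2 * γ * (c + 1)) with hc₀
  have hc₀0 : 0 < c₀ := by rw [hc₀]; positivity
  refine ⟨c₀, hc₀0, fun {ν T} hν hT {u p} h hmean hsmall => ?_⟩
  set κ : ℝ := c * ν ^ (-α) with hκ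
  have hκ0 : 0 ≤ κ := mul_nonneg hc0 (Real.rpow_nonneg hν.le _)
  -- notation for the `Ḣ^s` sum of the slices
  set X : ℝ → ℝ := fun τ => ∑' k : d → ℤ, freqNormSq k ^ s *
    ‖mFourierCoeff (EuclideanSpace.complexify ∘ u τ) k‖ ^ 2 with hX
  have hXnn : ∀ τ, 0 ≤ X τ := fun τ => tsum_nonneg fun k =>
    mul_nonneg (Real.rpow_nonneg (freqNormSq_nonneg k) _) (sq_nonneg _)
  -- `γ κ T ≤ X(0)^{-γ} / 2` when `X(0) > 0`
  have hTκ : 0 < X 0 → γ * κ * T ≤ (X 0) ^ (-γ) / 2 := by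
    intro hX00
    have h1 : T ≤ c₀ * ν ^ α * (X 0) ^ (-γ) := by
      have hXγ : 0 < X 0 ^ γ := Real.rpow_pos_of_pos hX00 γ
      rw [Real.rpow_neg (hXnn 0), ← div_eq_mul_inv, le_div_iff₀ hXγ]
      exact hsmall
    have h2 : γ * κ * (c₀ * ν ^ α * (X 0) ^ (-γ)) ≤ (X 0) ^ (-γ) / 2 := by
      rw [hκ, hc₀]
      have hνα : ν ^ (-α) * ν ^ α = 1 := by
        rw [← Real.rpow_add hν, neg_add_cancel, Real.rpow_zero]
      have hXγ0 : 0 ≤ X 0 ^ (-γ) := Real.rpow_nonneg (hXnn 0) _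
      calc γ * (c * ν ^ (-α)) * (1 / (2 * γ * (c + 1)) * ν ^ α * X 0 ^ (-γ))
          = (c / (c + 1)) * (ν ^ (-α) * ν ^ α) * X 0 ^ (-γ) / 2 := by
            field_simp
        _ ≤ 1 * 1 * X 0 ^ (-γ) / 2 := by
            rw [hνα]
            gcongr
            · rw [div_le_one (by linarith)]; linarith
        _ = X 0 ^ (-γ) / 2 := by ring
    calc γ * κ * T ≤ γ * κ * (c₀ * ν ^ α * (X 0) ^ (-γ)) :=
          mul_le_mul_of_nonneg_left h1 (mul_nonneg hγ0.le hκ0)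
      _ ≤ (X 0) ^ (-γ) / 2 := h2
  -- ### Step A: the bound on `[0, T)` by comparison on the closed windows `[0, T₁]`, `T₁ < T`
  have hbound : ∀ t ∈ Ico 0 T, X t ≤ (2 : ℝ) ^ ((2 * s - 1) / 2) * X 0 := by
    intro t ht
    set T₁ : ℝ := (t + T) / 2 with hT₁
    have htT₁ : t < T₁ := by rw [hT₁]; linarith [ht.2]
    have hT₁T : T₁ < T := by rw [hT₁]; linarith [ht.2]
    have hT₁0 : 0 < T₁ := lt_of_le_of_lt ht.1 htT₁
    have hsub : Icc 0 T₁ ⊆ Ico 0 T := fun τ hτ => ⟨hτ.1, lt_of_le_of_lt hτ.2 hT₁T⟩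
    have h₁ : Torus.IsClassicalNSSolutionOn (Icc 0 T₁) ν 0 u p :=
      h.mono hsub (uniqueDiffOn_Icc hT₁0)
    have hmean₁ : ∀ τ ∈ Icc 0 T₁, HasZeroMean (u τ) := fun τ hτ => hmean τ (hsub hτ)
    have hXc : ContinuousOn X (Icc 0 T₁) :=
      continuousOn_tsum_rpow_mul_norm_sq hT₁0 h₁.smooth_velocity (by linarith)
        (by rw [hn]; linarith)
    have hXd : ∀ τ ∈ Ioo 0 T₁, HasDerivAt X (deriv X τ) τ ∧ deriv X τ ≤ κ * X τ ^ β := by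
      intro τ hτ
      obtain ⟨D, hD, hle⟩ := hc hν hT₁0 h₁ hmean₁ τ hτ
      refine ⟨hD.differentiableAt.hasDerivAt, ?_⟩
      rw [hD.deriv]
      refine hle.trans ?_
      have hZ0 : 0 ≤ ∑' k : d → ℤ, freqNormSq k ^ (s + 1) *
          ‖mFourierCoeff (EuclideanSpace.complexify ∘ u τ) k‖ ^ 2 := tsum_nonneg fun k =>
        mul_nonneg (Real.rpow_nonneg (freqNormSq_nonneg k) _) (sq_nonneg _)
      have hneg : -(4 * Real.pi ^ 2 * ν) * (∑' k : d → ℤ, freqNormSq k ^ (s + 1) *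
          ‖mFourierCoeff (EuclideanSpace.complexify ∘ u τ) k‖ ^ 2) ≤ 0 :=
        mul_nonpos_of_nonpos_of_nonneg (by have := Real.pi_pos; nlinarith [hν]) hZ0
      have : c * ν ^ (-((5 - 2 * s) / (2 * s - 1))) * X τ ^ ((2 * s + 1) / (2 * s - 1)) =
          κ * X τ ^ β := by rw [hκ, hα, hβ]
      linarith [this]
    have hcomp := fun (δ : ℝ) (hδ : 0 < δ) =>
      rpow_add_le_of_deriv_le (X := X) (X' := deriv X) hT₁0 hκ0 hβ1 (fun τ _ => hXnn τ) hXc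
        (fun τ hτ => (hXd τ hτ).1) (fun τ hτ => (hXd τ hτ).2) hδ
        (show t ∈ Icc 0 T₁ from ⟨ht.1, htT₁.le⟩)
    -- hcomp δ hδ : (X 0 + δ)^(1-β) ≤ (X t + δ)^(1-β) + (β-1) κ (t - 0)
    have h1β : 1 - β = -γ := by rw [hβγ]; ring
    have hβ1' : β - 1 = γ := by rw [hβγ]; ring
    by_cases hXt : X t = 0
    · rw [hXt]; exact mul_nonneg (Real.rpow_nonneg (by norm_num) _) (hXnn 0)
    have hXt0 : 0 < X t := lt_of_le_of_ne (hXnn t) (Ne.symm hXt)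
    have htT : (β - 1) * κ * (t - 0) ≤ γ * κ * T := by
      rw [hβ1', sub_zero]
      exact mul_le_mul_of_nonneg_left ht.2.le (mul_nonneg hγ0.le hκ0)
    -- from the regularised comparison: `(X 0 + δ)^{-γ} ≤ X(t)^{-γ} + γ κ T` for all `δ > 0`
    have hkey : ∀ δ : ℝ, 0 < δ → (X 0 + δ) ^ (-γ) ≤ X t ^ (-γ) + γ * κ * T := by
      intro δ hδ
      have h1 := hcomp δ hδ
      rw [h1β] at h1
      have h2 : (X t + δ) ^ (-γ) ≤ X t ^ (-γ) :=
        Real.rpow_le_rpow_of_nonpos hXt0 (by linarith) (by linarith)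
      linarith
    -- `X 0 > 0` (otherwise `δ^{-γ} ≤ const` for all small `δ`, absurd)
    have hX00 : 0 < X 0 := by
      by_contra hcon
      have hX0z : X 0 = 0 := le_antisymm (not_lt.1 hcon) (hXnn 0)
      set R₀ : ℝ := X t ^ (-γ) + γ * κ * T + 1 with hR₀
      have hR₀0 : 0 < R₀ := by
        have := Real.rpow_nonneg (hXnn t) (-γ)
        have := mul_nonneg (mul_nonneg hγ0.le hκ0) hT.le
        rw [hR₀]; linarith
      set δ : ℝ := R₀ ^ (-(1 / γ)) with hδ
      have hδ0 : 0 < δ := Real.rpow_pos_of_pos hR₀0 _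
      have hδγ : δ ^ (-γ) = R₀ := by
        rw [hδ, ← Real.rpow_mul hR₀0.le, show -(1 / γ) * -γ = 1 by field_simp, Real.rpow_one]
      have := hkey δ hδ0
      rw [hX0z, zero_add, hδγ, hR₀] at this
      linarith
    -- `X 0 ^ {-γ} ≤ X t ^{-γ} + γ κ T` by letting `δ → 0`
    have hlim : (X 0) ^ (-γ) ≤ X t ^ (-γ) + γ * κ * T := by
      by_contra hcon
      push Not at hcon
      have hcont : Filter.Tendsto (fun δ : ℝ => (X 0 + δ) ^ (-γ)) (𝓝 0) (𝓝 ((X 0) ^ (-γ))) := by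
        have h1 : ContinuousAt (fun δ : ℝ => (X 0 + δ) ^ (-γ)) 0 :=
          (continuousAt_const.add continuousAt_id).rpow_const (Or.inl (by simp; exact hX00.ne'))
        have h2 := h1.tendsto
        simp only [add_zero] at h2
        exact h2
      have hev := (hcont.eventually_const_lt hcon).filter_mono (nhdsWithin_le_nhds (s := Ioi (0:ℝ)))
      obtain ⟨δ, hδ0, hδ⟩ := ((eventually_mem_nhdsWithin (a := (0:ℝ)) (s := Ioi 0)).and hev).exists
      exact absurd (hkey δ hδ0) (not_le.2 hδ)
    -- conclude: `X t ^{-γ} ≥ X 0^{-γ}/2`, i.e. `X t ≤ 2^{1/γ} X 0`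
    have hXtγ : (X 0) ^ (-γ) / 2 ≤ X t ^ (-γ) := by linarith [hTκ hX00]
    have hX0γ : 0 < (X 0) ^ (-γ) / 2 := by
      have := Real.rpow_pos_of_pos hX00 (-γ); linarith
    calc X t = (X t ^ (-γ)) ^ (-(1 / γ)) := by
          rw [← Real.rpow_mul (hXnn t), show -γ * -(1 / γ) = 1 by field_simp, Real.rpow_one]
      _ ≤ ((X 0) ^ (-γ) / 2) ^ (-(1 / γ)) :=
          Real.rpow_le_rpow_of_nonpos hX0γ hXtγ (by rw [neg_nonpos]; positivity)
      _ = (2 : ℝ) ^ ((2 * s - 1) / 2) * X 0 := by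
          rw [Real.div_rpow (Real.rpow_nonneg (hXnn 0) _) (by norm_num), ← Real.rpow_mul (hXnn 0),
            show -γ * -(1 / γ) = 1 by field_simp, Real.rpow_one, div_eq_mul_inv, ← Real.rpow_neg
            (by norm_num : (0:ℝ) ≤ 2), neg_neg, mul_comm]
          congr 2
          rw [hγ]
          field_simp
  refine ⟨hbound, ?_⟩
  -- ### Step B: continuation by the Serrin criterion at the exponent `q = 6/(3 − 2s₀) > 3`
  set q : ℝ := 6 / (3 - 2 * s₀) with hq
  have h32s : 0 < 3 - 2 * s₀ := by linarith
  have hq3 : 3 < q := by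
    rw [hq, lt_div_iff₀ h32s]; linarith
  have hq0 : 0 < q := by linarith
  set Bnd : ℝ := (2 : ℝ) ^ ((2 * s - 1) / 2) * X 0 with hBnd
  have hBnd0 : 0 ≤ Bnd := mul_nonneg (Real.rpow_nonneg (by norm_num) _) (hXnn 0)
  set N₀ : ℝ := (CE * Bnd) ^ (1 / 2 : ℝ) with hN₀
  have hN₀0 : 0 ≤ N₀ := Real.rpow_nonneg (mul_nonneg hCE0.le hBnd0) _
  -- `‖u(t)‖²_{Ḣ^{s₀}} ≤ ‖u(t)‖²_{Ḣ^s}` (mean zero: `|k| ≥ 1` on the support)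
  have hmono : ∀ t ∈ Ico 0 T, ∑' k : d → ℤ, freqNormSq k ^ s₀ *
      ‖mFourierCoeff (EuclideanSpace.complexify ∘ u t) k‖ ^ 2 ≤ X t := by
    intro t ht
    have hut : IsSmooth (u t) := h.smooth_velocity.isSmooth_slice ht
    refine Summable.tsum_le_tsum (fun k => ?_)
      (hut.summable_freqNormSq_rpow_mul_norm_sq (by linarith))
      (hut.summable_freqNormSq_rpow_mul_norm_sq (by linarith))
    refine mul_le_mul_of_nonneg_right ?_ (sq_nonneg _)
    by_cases hk : k = 0
    · rw [hk, freqNormSq_zero, Real.zero_rpow (by linarith), Real.zero_rpow (by linarith)]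
    · exact Real.rpow_le_rpow_of_exponent_le (one_le_freqNormSq_of_ne_zero hk) hs₀s
  -- `‖u(t)‖_{L^q} ≤ N₀` on `[0, T)`
  have hN : ∀ t ∈ Ico 0 T, (∫ x, ‖u t x‖ ^ q) ^ (1 / q) ≤ N₀ := by
    intro t ht
    have hut : IsSmooth (u t) := h.smooth_velocity.isSmooth_slice ht
    have hE := hCE (u t) hut (hmean t ht)
    have e1 : 2 * (Fintype.card d : ℝ) / ((Fintype.card d : ℝ) - 2 * s₀) = q := by
      rw [hn, hq]; norm_num
    have e2 : ((Fintype.card d : ℝ) - 2 * s₀) / (Fintype.card d : ℝ) = (1 / q) * 2 := by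
      rw [hn, hq]
      field_simp
      norm_num
    rw [e1, e2, Real.rpow_mul (integral_nonneg fun x => Real.rpow_nonneg (norm_nonneg _) _)] at hE
    -- hE : ((∫‖u‖^q)^(1/q))^2 ≤ CE * X_{s₀} t
    have hI0 : 0 ≤ (∫ x, ‖u t x‖ ^ q) ^ (1 / q) :=
      Real.rpow_nonneg (integral_nonneg fun x => Real.rpow_nonneg (norm_nonneg _) _) _
    have hle : ((∫ x, ‖u t x‖ ^ q) ^ (1 / q)) ^ (2 : ℝ) ≤ CE * Bnd :=
      hE.trans (mul_le_mul_of_nonneg_left ((hmono t ht).trans (hbound t ht)) hCE0.le)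
    calc (∫ x, ‖u t x‖ ^ q) ^ (1 / q)
        = ((((∫ x, ‖u t x‖ ^ q) ^ (1 / q)) ^ (2 : ℝ))) ^ (1 / 2 : ℝ) := by
          rw [← Real.rpow_mul hI0]; norm_num
      _ ≤ (CE * Bnd) ^ (1 / 2 : ℝ) := Real.rpow_le_rpow (Real.rpow_nonneg hI0 _) hle (by norm_num)
  have hI : ∀ t ∈ Ico 0 T, ∫ τ in (0 : ℝ)..t, (fun _ : ℝ => N₀) τ ^ (2 * q / (q - 3)) ≤
      T * N₀ ^ (2 * q / (q - 3)) := by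
    intro t ht
    rw [intervalIntegral.integral_const, smul_eq_mul, sub_zero]
    exact mul_le_mul_of_nonneg_right ht.2.le (Real.rpow_nonneg hN₀0 _)
  exact Torus.classicalNS_continuation_of_Ls_rpow_integral_le hd hν hT hq3 h hmean
    continuousOn_const (fun _ _ => hN₀0) hN hI


/-! #### Windows: the `Ḣ^s` energy at most doubles on windows of length
`≲ ν^α ‖u(a)‖_{Ḣ^s}^{-4/(2s-1)}`, and the `Ḣ^s` blow-up rate under `Ḣ^s`-unboundedness -/

/-- (WHOLE range `1/2 < s < 5/2`, the borderline `s = 3/2` INCLUDED — Cortissoz–Montero 2015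
Thm 2.1 / Cor 2.1 supply the law at `s = 3/2` (`NSSobolev.hsSeminorm_sq_deriv_le_rpow''`); the
proof below is that of the `s ≠ 3/2` version in `TorusNSSobolevLifespan`, verbatim, fed with the
borderline-inclusive law; the continuation step uses the level `min s 1`.)
**Window bound**: for `card d = 3`, `1/2 < s < 5/2` there is `c₀ = c₀(s) > 0` such that for a
classical mean-zero solution on a closed window `[a, b] × T³` (zero force) with
`(b − a) (‖u(a)‖²_{Ḣ^s})^{2/(2s−1)} ≤ c₀ ν^{(5−2s)/(2s−1)}` one has
`‖u(t)‖²_{Ḣ^s} ≤ 2^{(2s−1)/2} ‖u(a)‖²_{Ḣ^s}` for all `t ∈ [a, b]` (comparison for the rate law: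
the regularised quantity `(X+δ)^{−γ} + γκt`, `γ = 2/(2s−1)`, is non-decreasing;
Robinson–Sadowski–Silva (4.1)).
[cite: CortissozMontero2015, §2 Thm 2.1 (proof, last display);
RobinsonSadowskiSilva2012, §IV (4.1)] -/
theorem hsSeminorm_sq_le_of_window'' (hd : Fintype.card d = 3) {s : ℝ}
    (hs : 1 / 2 < s) (hs' : s < 5 / 2) :
    ∃ c₀ : ℝ, 0 < c₀ ∧ ∀ {ν a b : ℝ}, 0 < ν → a < b →
      ∀ {u : ℝ → UnitAddTorus d → EuclideanSpace ℝ d} {p : ℝ → UnitAddTorus d → ℝ},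
      Torus.IsClassicalNSSolutionOn (Icc a b) ν 0 u p → (∀ t ∈ Icc a b, HasZeroMean (u t)) →
      (b - a) * (∑' k : d → ℤ, freqNormSq k ^ s *
          ‖mFourierCoeff (EuclideanSpace.complexify ∘ u a) k‖ ^ 2) ^ (2 / (2 * s - 1)) ≤
        c₀ * ν ^ ((5 - 2 * s) / (2 * s - 1)) →
      ∀ t ∈ Icc a b, (∑' k : d → ℤ, freqNormSq k ^ s *
          ‖mFourierCoeff (EuclideanSpace.complexify ∘ u t) k‖ ^ 2) ≤
        (2 : ℝ) ^ ((2 * s - 1) / 2) * ∑' k : d → ℤ, freqNormSq k ^ s *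
          ‖mFourierCoeff (EuclideanSpace.complexify ∘ u a) k‖ ^ 2 := by
  classical
  have hn : (Fintype.card d : ℝ) = 3 := by rw [hd]; norm_num
  obtain ⟨c, hc0, hc⟩ := hsSeminorm_sq_deriv_le_rpow'' hd hs hs'
  set γ : ℝ := 2 / (2 * s - 1) with hγ
  set β : ℝ := (2 * s + 1) / (2 * s - 1) with hβ
  set α : ℝ := (5 - 2 * s) / (2 * s - 1) with hα
  have hs1 : (0 : ℝ) < 2 * s - 1 := by linarith
  have hγ0 : 0 < γ := by rw [hγ]; positivity
  have hβγ : β = 1 + γ := by rw [hβ, hγ]; field_simp; ring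
  have hβ1 : 1 < β := by rw [hβγ]; linarith
  set c₀ : ℝ := 1 / (2 * γ * (c + 1)) with hc₀
  have hc₀0 : 0 < c₀ := by rw [hc₀]; positivity
  refine ⟨c₀, hc₀0, fun {ν a b} hν hab {u p} h hmean hsmall t ht => ?_⟩
  set κ : ℝ := c * ν ^ (-α) with hκ
  have hκ0 : 0 ≤ κ := mul_nonneg hc0 (Real.rpow_nonneg hν.le _)
  set X : ℝ → ℝ := fun τ => ∑' k : d → ℤ, freqNormSq k ^ s *
    ‖mFourierCoeff (EuclideanSpace.complexify ∘ u τ) k‖ ^ 2 with hX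
  have hXnn : ∀ τ, 0 ≤ X τ := fun τ => tsum_nonneg fun k =>
    mul_nonneg (Real.rpow_nonneg (freqNormSq_nonneg k) _) (sq_nonneg _)
  show X t ≤ (2 : ℝ) ^ ((2 * s - 1) / 2) * X a
  -- `γ κ (b − a) ≤ X(a)^{-γ} / 2` when `X(a) > 0`
  have hTκ : 0 < X a → γ * κ * (b - a) ≤ (X a) ^ (-γ) / 2 := by
    intro hXa0
    have h1 : b - a ≤ c₀ * ν ^ α * (X a) ^ (-γ) := by
      have hXγ : 0 < X a ^ γ := Real.rpow_pos_of_pos hXa0 γ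
      rw [Real.rpow_neg (hXnn a), ← div_eq_mul_inv, le_div_iff₀ hXγ]
      exact hsmall
    have h2 : γ * κ * (c₀ * ν ^ α * (X a) ^ (-γ)) ≤ (X a) ^ (-γ) / 2 := by
      rw [hκ, hc₀]
      have hνα : ν ^ (-α) * ν ^ α = 1 := by
        rw [← Real.rpow_add hν, neg_add_cancel, Real.rpow_zero]
      have hXγ0 : 0 ≤ X a ^ (-γ) := Real.rpow_nonneg (hXnn a) _
      calc γ * (c * ν ^ (-α)) * (1 / (2 * γ * (c + 1)) * ν ^ α * X a ^ (-γ))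
          = (c / (c + 1)) * (ν ^ (-α) * ν ^ α) * X a ^ (-γ) / 2 := by
            field_simp
        _ ≤ 1 * 1 * X a ^ (-γ) / 2 := by
            rw [hνα]
            gcongr
            · rw [div_le_one (by linarith)]; linarith
        _ = X a ^ (-γ) / 2 := by ring
    calc γ * κ * (b - a) ≤ γ * κ * (c₀ * ν ^ α * (X a) ^ (-γ)) :=
          mul_le_mul_of_nonneg_left h1 (mul_nonneg hγ0.le hκ0)
      _ ≤ (X a) ^ (-γ) / 2 := h2
  have hmean' : ∀ τ ∈ Icc a b, HasZeroMean (u τ) := hmean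
  have hXc : ContinuousOn X (Icc a b) :=
    continuousOn_tsum_rpow_mul_norm_sq hab h.smooth_velocity (by linarith) (by rw [hn]; linarith)
  have hXd : ∀ τ ∈ Ioo a b, HasDerivAt X (deriv X τ) τ ∧ deriv X τ ≤ κ * X τ ^ β := by
    intro τ hτ
    obtain ⟨D, hD, hle⟩ := hc hν hab h hmean' τ hτ
    refine ⟨hD.differentiableAt.hasDerivAt, ?_⟩
    rw [hD.deriv]
    refine hle.trans ?_
    have hZ0 : 0 ≤ ∑' k : d → ℤ, freqNormSq k ^ (s + 1) *
        ‖mFourierCoeff (EuclideanSpace.complexify ∘ u τ) k‖ ^ 2 := tsum_nonneg fun k =>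
      mul_nonneg (Real.rpow_nonneg (freqNormSq_nonneg k) _) (sq_nonneg _)
    have hneg : -(4 * Real.pi ^ 2 * ν) * (∑' k : d → ℤ, freqNormSq k ^ (s + 1) *
        ‖mFourierCoeff (EuclideanSpace.complexify ∘ u τ) k‖ ^ 2) ≤ 0 :=
      mul_nonpos_of_nonpos_of_nonneg (by have := Real.pi_pos; nlinarith [hν]) hZ0
    have : c * ν ^ (-((5 - 2 * s) / (2 * s - 1))) * X τ ^ ((2 * s + 1) / (2 * s - 1)) =
        κ * X τ ^ β := by rw [hκ, hα, hβ]
    linarith [this]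
  have hcomp := fun (δ : ℝ) (hδ : 0 < δ) =>
    rpow_add_le_of_deriv_le (X := X) (X' := deriv X) hab hκ0 hβ1 (fun τ _ => hXnn τ) hXc
      (fun τ hτ => (hXd τ hτ).1) (fun τ hτ => (hXd τ hτ).2) hδ ht
  have h1β : 1 - β = -γ := by rw [hβγ]; ring
  have hβ1' : β - 1 = γ := by rw [hβγ]; ring
  by_cases hXt : X t = 0
  · rw [hXt]; exact mul_nonneg (Real.rpow_nonneg (by norm_num) _) (hXnn a)
  have hXt0 : 0 < X t := lt_of_le_of_ne (hXnn t) (Ne.symm hXt)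
  have htT : (β - 1) * κ * (t - a) ≤ γ * κ * (b - a) := by
    rw [hβ1']
    exact mul_le_mul_of_nonneg_left (by linarith [ht.2]) (mul_nonneg hγ0.le hκ0)
  have hkey : ∀ δ : ℝ, 0 < δ → (X a + δ) ^ (-γ) ≤ X t ^ (-γ) + γ * κ * (b - a) := by
    intro δ hδ
    have h1 := hcomp δ hδ
    rw [h1β] at h1
    have h2 : (X t + δ) ^ (-γ) ≤ X t ^ (-γ) :=
      Real.rpow_le_rpow_of_nonpos hXt0 (by linarith) (by linarith)
    linarith
  have hXa0 : 0 < X a := by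
    by_contra hcon
    have hX0z : X a = 0 := le_antisymm (not_lt.1 hcon) (hXnn a)
    set R₀ : ℝ := X t ^ (-γ) + γ * κ * (b - a) + 1 with hR₀
    have hR₀0 : 0 < R₀ := by
      have := Real.rpow_nonneg (hXnn t) (-γ)
      have := mul_nonneg (mul_nonneg hγ0.le hκ0) (by linarith : (0 : ℝ) ≤ b - a)
      rw [hR₀]; linarith
    set δ : ℝ := R₀ ^ (-(1 / γ)) with hδ
    have hδ0 : 0 < δ := Real.rpow_pos_of_pos hR₀0 _
    have hδγ : δ ^ (-γ) = R₀ := by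
      rw [hδ, ← Real.rpow_mul hR₀0.le, show -(1 / γ) * -γ = 1 by field_simp, Real.rpow_one]
    have := hkey δ hδ0
    rw [hX0z, zero_add, hδγ, hR₀] at this
    linarith
  have hlim : (X a) ^ (-γ) ≤ X t ^ (-γ) + γ * κ * (b - a) := by
    by_contra hcon
    push Not at hcon
    have hcont : Filter.Tendsto (fun δ : ℝ => (X a + δ) ^ (-γ)) (𝓝 0) (𝓝 ((X a) ^ (-γ))) := by
      have h1 : ContinuousAt (fun δ : ℝ => (X a + δ) ^ (-γ)) 0 :=
        (continuousAt_const.add continuousAt_id).rpow_const (Or.inl (by simp; exact hXa0.ne'))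
      have h2 := h1.tendsto
      simp only [add_zero] at h2
      exact h2
    have hev := (hcont.eventually_const_lt hcon).filter_mono (nhdsWithin_le_nhds (s := Ioi (0:ℝ)))
    obtain ⟨δ, hδ0, hδ⟩ := ((eventually_mem_nhdsWithin (a := (0:ℝ)) (s := Ioi 0)).and hev).exists
    exact absurd (hkey δ hδ0) (not_le.2 hδ)
  have hXtγ : (X a) ^ (-γ) / 2 ≤ X t ^ (-γ) := by linarith [hTκ hXa0]
  have hX0γ : 0 < (X a) ^ (-γ) / 2 := by
    have := Real.rpow_pos_of_pos hXa0 (-γ); linarith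
  calc X t = (X t ^ (-γ)) ^ (-(1 / γ)) := by
        rw [← Real.rpow_mul (hXnn t), show -γ * -(1 / γ) = 1 by field_simp, Real.rpow_one]
    _ ≤ ((X a) ^ (-γ) / 2) ^ (-(1 / γ)) :=
        Real.rpow_le_rpow_of_nonpos hX0γ hXtγ (by rw [neg_nonpos]; positivity)
    _ = (2 : ℝ) ^ ((2 * s - 1) / 2) * X a := by
        rw [Real.div_rpow (Real.rpow_nonneg (hXnn a) _) (by norm_num), ← Real.rpow_mul (hXnn a),
          show -γ * -(1 / γ) = 1 by field_simp, Real.rpow_one, div_eq_mul_inv, ← Real.rpow_neg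
          (by norm_num : (0:ℝ) ≤ 2), neg_neg, mul_comm]
        congr 2
        rw [hγ]
        field_simp

/-- (WHOLE range `1/2 < s < 5/2`, the borderline `s = 3/2` INCLUDED — Cortissoz–Montero 2015
Thm 2.1 / Cor 2.1 supply the law at `s = 3/2` (`NSSobolev.hsSeminorm_sq_deriv_le_rpow''`); the
proof below is that of the `s ≠ 3/2` version in `TorusNSSobolevLifespan`, verbatim, fed with the
borderline-inclusive law; the continuation step uses the level `min s 1`.)
**The `Ḣ^s` blow-up rate from the `Ḣ^s` balance, borderline included** (Cortissoz–Montero 2015,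
Thm 2.1: "Let `u` be a solution … whose maximum interval of existence is `(0,T)` … with
`1/2 < s < 5/2`. Then `C_s / t^{½(s−½)} ≤ ‖u(T−s)‖_{Ḣ^s(T³)}`"; Robinson–Sadowski–Silva (2.2)/(4.2)
for `s ≠ 3/2`), classical torus form, `ν`-scaled, under unboundedness of the `Ḣ^s` norm itself:
for `card d = 3` and `1/2 < s < 5/2` there is `c₀ = c₀(s) > 0` such that every classical mean-zero
solution on `[a, T) × T³` (zero force) whose `Ḣ^s` energy `X(t) = ∑_k |k|^{2s}‖û(t,k)‖²` is
unbounded on `[a, T)` satisfies `X(t) ≥ (c₀ ν^{(5−2s)/(2s−1)} / (T − t))^{(2s−1)/2}` for all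
`t ∈ [a, T)`, i.e. `‖u(t)‖_{Ḣ^s} ≥ c ν^{(5−2s)/4} (T − t)^{−(2s−1)/4}`; at `s = 3/2` this is the
OPTIMAL rate `‖u(t)‖²_{Ḣ^{3/2}} ≥ c₀ ν/(T − t)`
(`NSSobolev.hsSeminorm_sq_three_halves_blowup_rate`),
where RSS's §V.A / `NSSobolev.hsSeminorm_sq_blowup_rate_three_halves` reach only
`(T−t)^{−1/2+O(ε)}`. [cite: CortissozMontero2015, §2 Thm 2.1 (2.1) (arXiv p. 4);
RobinsonSadowskiSilva2012, §IV (4.2), (2.2)] -/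
theorem hsSeminorm_sq_blowup_rate'' (hd : Fintype.card d = 3) {s : ℝ} (hs : 1 / 2 < s)
    (hs' : s < 5 / 2) :
    ∃ c₀ : ℝ, 0 < c₀ ∧ ∀ {ν a T : ℝ}, 0 < ν →
      ∀ {u : ℝ → UnitAddTorus d → EuclideanSpace ℝ d} {p : ℝ → UnitAddTorus d → ℝ},
      Torus.IsClassicalNSSolutionOn (Ico a T) ν 0 u p → (∀ t ∈ Ico a T, HasZeroMean (u t)) →
      ¬ BddAbove ((fun t => ∑' k : d → ℤ, freqNormSq k ^ s *
          ‖mFourierCoeff (EuclideanSpace.complexify ∘ u t) k‖ ^ 2) '' Ico a T) →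
      ∀ t ∈ Ico a T, (c₀ * ν ^ ((5 - 2 * s) / (2 * s - 1)) / (T - t)) ^ ((2 * s - 1) / 2) ≤
        ∑' k : d → ℤ, freqNormSq k ^ s *
          ‖mFourierCoeff (EuclideanSpace.complexify ∘ u t) k‖ ^ 2 := by
  classical
  have hn : (Fintype.card d : ℝ) = 3 := by rw [hd]; norm_num
  obtain ⟨c₀, hc₀0, hW⟩ := hsSeminorm_sq_le_of_window'' hd hs hs'
  refine ⟨c₀, hc₀0, fun {ν a T} hν {u p} h hmean hunb t ht => ?_⟩
  have hs1 : (0 : ℝ) < 2 * s - 1 := by linarith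
  set γ : ℝ := 2 / (2 * s - 1) with hγ
  have hγ0 : 0 < γ := by rw [hγ]; positivity
  set α : ℝ := (5 - 2 * s) / (2 * s - 1) with hα
  set X : ℝ → ℝ := fun τ => ∑' k : d → ℤ, freqNormSq k ^ s *
    ‖mFourierCoeff (EuclideanSpace.complexify ∘ u τ) k‖ ^ 2 with hX
  have hXnn : ∀ τ, 0 ≤ X τ := fun τ => tsum_nonneg fun k =>
    mul_nonneg (Real.rpow_nonneg (freqNormSq_nonneg k) _) (sq_nonneg _)
  show (c₀ * ν ^ α / (T - t)) ^ ((2 * s - 1) / 2) ≤ X t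
  have htT : 0 < T - t := by linarith [ht.2]
  have hL0 : 0 < c₀ * ν ^ α / (T - t) := div_pos (mul_pos hc₀0 (Real.rpow_pos_of_pos hν _)) htT
  by_contra hlt
  rw [not_le] at hlt
  -- then `(T - t) X(t)^γ < c₀ ν^α`
  have hsmall : (T - t) * X t ^ γ < c₀ * ν ^ α := by
    have h1 : X t ^ γ < ((c₀ * ν ^ α / (T - t)) ^ ((2 * s - 1) / 2)) ^ γ :=
      Real.rpow_lt_rpow (hXnn t) hlt hγ0
    rw [← Real.rpow_mul hL0.le, show (2 * s - 1) / 2 * γ = 1 by rw [hγ]; field_simp,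
      Real.rpow_one] at h1
    calc (T - t) * X t ^ γ < (T - t) * (c₀ * ν ^ α / (T - t)) := mul_lt_mul_of_pos_left h1 htT
      _ = c₀ * ν ^ α := by field_simp
  apply hunb
  -- bound on `[t, T)` from the window lemma, on `[a, t]` by continuity
  have hright : ∀ τ ∈ Ico t T, X τ ≤ (2 : ℝ) ^ ((2 * s - 1) / 2) * X t := by
    intro τ hτ
    rcases hτ.1.eq_or_lt with h0 | htτ
    · rw [← h0]
      have : (1 : ℝ) ≤ (2 : ℝ) ^ ((2 * s - 1) / 2) := Real.one_le_rpow (by norm_num) (by positivity)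
      nlinarith [hXnn t]
    · set b : ℝ := (τ + T) / 2 with hb
      have hτb : τ < b := by rw [hb]; linarith [hτ.2]
      have hbT : b < T := by rw [hb]; linarith [hτ.2]
      have htb : t < b := htτ.trans hτb
      have hsub : Icc t b ⊆ Ico a T := fun r hr => ⟨ht.1.trans hr.1, lt_of_le_of_lt hr.2 hbT⟩
      have h' : Torus.IsClassicalNSSolutionOn (Icc t b) ν 0 u p :=
        h.mono hsub (uniqueDiffOn_Icc htb)
      have hsm : (b - t) * X t ^ γ ≤ c₀ * ν ^ α := by
        have : (b - t) * X t ^ γ ≤ (T - t) * X t ^ γ :=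
          mul_le_mul_of_nonneg_right (by linarith) (Real.rpow_nonneg (hXnn t) _)
        linarith
      exact hW hν htb h' (fun r hr => hmean r (hsub hr)) hsm τ ⟨htτ.le, hτb.le⟩
  -- the left part `[a, t]`
  have hleft : BddAbove (X '' Icc a t) := by
    rcases ht.1.eq_or_lt with h0 | hat
    · rw [← h0, Set.Icc_self, Set.image_singleton]
      exact bddAbove_singleton
    · have hsub : Icc a t ⊆ Ico a T := fun r hr => ⟨hr.1, lt_of_le_of_lt hr.2 ht.2⟩
      have h' : Torus.IsClassicalNSSolutionOn (Icc a t) ν 0 u p :=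
        h.mono hsub (uniqueDiffOn_Icc hat)
      have hXc : ContinuousOn X (Icc a t) :=
        continuousOn_tsum_rpow_mul_norm_sq hat h'.smooth_velocity (by linarith)
          (by rw [hn]; linarith)
      exact (isCompact_Icc.image_of_continuousOn hXc).bddAbove
  obtain ⟨B₁, hB₁⟩ := hleft
  refine ⟨max B₁ ((2 : ℝ) ^ ((2 * s - 1) / 2) * X t), ?_⟩
  rintro _ ⟨τ, hτ, rfl⟩
  rcases le_or_gt τ t with hτt | htτ
  · exact (hB₁ ⟨τ, ⟨hτ.1, hτt⟩, rfl⟩).trans (le_max_left _ _)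
  · exact (hright τ ⟨htτ.le, hτ.2⟩).trans (le_max_right _ _)

/-! #### The rate read off the enstrophy -/

/-- **The `Ḣ^s` blow-up rate under the classical (enstrophy) blow-up hypothesis, for every
`1 ≤ s < 5/2`, borderline `s = 3/2` included** (Cortissoz–Montero 2015 Thm 2.1 at `s = 3/2`;
Robinson–Sadowski–Silva 2012 (2.2) for `s ≠ 3/2`), classical torus form: for `card d = 3` there is
`c₀ = c₀(s) > 0` such that every classical mean-zero solution on `[a, T) × T³` (zero force) with
`‖∇u(t)‖₂²` unbounded on `[a, T)` satisfies
`∑_k |k|^{2s}‖û(t,k)‖² ≥ (c₀ ν^{(5−2s)/(2s−1)} / (T − t))^{(2s−1)/2}` for all `t ∈ [a, T)`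
(mean zero and `s ≥ 1` give `‖∇u‖₂² = 4π²∑|k|²‖û‖² ≤ 4π² ∑|k|^{2s}‖û‖²`, so the `Ḣ^s` energy is
unbounded too; then `NSSobolev.hsSeminorm_sq_blowup_rate''`).
[cite: CortissozMontero2015, §2 Thm 2.1; RobinsonSadowskiSilva2012, §II (2.2), §IV (4.2)] -/
theorem hsSeminorm_sq_blowup_rate_of_not_bddAbove_gradNormSq'' (hd : Fintype.card d = 3)
    {s : ℝ} (hs1 : 1 ≤ s) (hs' : s < 5 / 2) :
    ∃ c₀ : ℝ, 0 < c₀ ∧ ∀ {ν a T : ℝ}, 0 < ν →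
      ∀ {u : ℝ → UnitAddTorus d → EuclideanSpace ℝ d} {p : ℝ → UnitAddTorus d → ℝ},
      Torus.IsClassicalNSSolutionOn (Ico a T) ν 0 u p → (∀ t ∈ Ico a T, HasZeroMean (u t)) →
      ¬ BddAbove ((fun t => Torus.gradNormSq (u t)) '' Ico a T) →
      ∀ t ∈ Ico a T, (c₀ * ν ^ ((5 - 2 * s) / (2 * s - 1)) / (T - t)) ^ ((2 * s - 1) / 2) ≤
        ∑' k : d → ℤ, freqNormSq k ^ s *
          ‖mFourierCoeff (EuclideanSpace.complexify ∘ u t) k‖ ^ 2 := by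
  classical
  obtain ⟨c₀, hc₀, H⟩ := hsSeminorm_sq_blowup_rate'' hd (by linarith) hs'
  refine ⟨c₀, hc₀, fun {ν a T} hν {u p} h hmean hunb t ht => H hν h hmean ?_ t ht⟩
  -- the `Ḣ^s` energy dominates the enstrophy, hence is unbounded
  intro hbdd
  apply hunb
  obtain ⟨M, hM⟩ := hbdd
  refine ⟨4 * Real.pi ^ 2 * M, ?_⟩
  rintro _ ⟨τ, hτ, rfl⟩
  have hX : ∑' k : d → ℤ, freqNormSq k ^ s *
      ‖mFourierCoeff (EuclideanSpace.complexify ∘ u τ) k‖ ^ 2 ≤ M := hM ⟨τ, hτ, rfl⟩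
  have huτ : IsSmooth (u τ) := h.smooth_velocity.isSmooth_slice hτ
  have hG := hasSum_freqNormSq_mul_norm_sq_mFourierCoeff huτ
  have hXs := huτ.summable_freqNormSq_rpow_mul_norm_sq (by linarith : (0 : ℝ) ≤ s)
  have hle : Torus.gradNormSq (u τ) ≤ 4 * Real.pi ^ 2 * ∑' k : d → ℤ, freqNormSq k ^ s *
      ‖mFourierCoeff (EuclideanSpace.complexify ∘ u τ) k‖ ^ 2 := by
    rw [← hG.tsum_eq, ← tsum_mul_left]
    refine Summable.tsum_le_tsum (fun k => ?_) hG.summable (hXs.mul_left _)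
    rw [← mul_assoc]
    refine mul_le_mul_of_nonneg_right (mul_le_mul_of_nonneg_left ?_ (by positivity)) (sq_nonneg _)
    by_cases hk : k = 0
    · rw [hk, freqNormSq_zero, Real.zero_rpow (by linarith)]
    · calc freqNormSq k = freqNormSq k ^ (1 : ℝ) := (Real.rpow_one _).symm
        _ ≤ freqNormSq k ^ s :=
            Real.rpow_le_rpow_of_exponent_le (one_le_freqNormSq_of_ne_zero hk) hs1
  show Torus.gradNormSq (u τ) ≤ 4 * Real.pi ^ 2 * M
  exact hle.trans (mul_le_mul_of_nonneg_left hX (by positivity))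



/-! ### §5 The borderline `s = 3/2`: Cortissoz–Montero's optimal `Ḣ^{3/2}` rate, clean form -/

/-- **Cortissoz–Montero 2015, Theorem 2.1 at `s = 3/2` — the OPTIMAL `Ḣ^{3/2}` blow-up rate on
`T³`** ("we … give a proof of the expected optimal lower blow-up rate … `C/t^{1/2} ≤
‖u(T−t)‖_{Ḣ^{3/2}(T³)}`", improving Cortissoz–Montero–Pinilla 2014's
`c/√((T−t)|log(T−t)|)`; also Cheskidov–Zaya 2016 and McCormick et al. 2016 by other methods),
classical torus form with the viscosity explicit: for `card d = 3` there is an absolute `c₀ > 0`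
such that every classical mean-zero solution of the unforced equations (`ν > 0`) on
`[a, T) × T³` whose `Ḣ^{3/2}` energy `X(t) = ∑_k |k|³‖û(t,k)‖²` is unbounded on `[a, T)`
satisfies `X(t) ≥ c₀ ν/(T − t)`, i.e. `‖u(t)‖_{Ḣ^{3/2}} ≥ (c₀ν)^{1/2}(T − t)^{−1/2}`, for all
`t ∈ [a, T)`. [cite: CortissozMontero2015, §1 (display) and §2 Thm 2.1 (arXiv pp. 3–4)] -/
theorem hsSeminorm_sq_three_halves_blowup_rate (hd : Fintype.card d = 3) :
    ∃ c₀ : ℝ, 0 < c₀ ∧ ∀ {ν a T : ℝ}, 0 < ν →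
      ∀ {u : ℝ → UnitAddTorus d → EuclideanSpace ℝ d} {p : ℝ → UnitAddTorus d → ℝ},
      Torus.IsClassicalNSSolutionOn (Ico a T) ν 0 u p → (∀ t ∈ Ico a T, HasZeroMean (u t)) →
      ¬ BddAbove ((fun t => ∑' k : d → ℤ, freqNormSq k ^ (3 / 2 : ℝ) *
          ‖mFourierCoeff (EuclideanSpace.complexify ∘ u t) k‖ ^ 2) '' Ico a T) →
      ∀ t ∈ Ico a T, c₀ * ν / (T - t) ≤
        ∑' k : d → ℤ, freqNormSq k ^ (3 / 2 : ℝ) *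
          ‖mFourierCoeff (EuclideanSpace.complexify ∘ u t) k‖ ^ 2 := by
  obtain ⟨c₀, hc₀, H⟩ := hsSeminorm_sq_blowup_rate'' hd (s := 3 / 2) (by norm_num) (by norm_num)
  refine ⟨c₀, hc₀, fun {ν a T} hν {u p} h hmean hunb t ht => ?_⟩
  have h1 := H hν h hmean hunb t ht
  have e1 : ((5 : ℝ) - 2 * (3 / 2)) / (2 * (3 / 2) - 1) = 1 := by norm_num
  have e2 : ((2 : ℝ) * (3 / 2) - 1) / 2 = 1 := by norm_num
  rw [e1, e2, Real.rpow_one, Real.rpow_one] at h1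
  exact h1

/-- **The optimal `Ḣ^{3/2}` rate read off the enstrophy** (Cortissoz–Montero 2015 Thm 2.1 at
`s = 3/2`, classical torus form): for `card d = 3` there is `c₀ > 0` such that every classical
mean-zero solution of the unforced equations (`ν > 0`) on `[a, T) × T³` with `‖∇u(t)‖₂²`
unbounded on `[a, T)` (no classical continuation past `T`, RRS 2016 Lemma 6.11) satisfies
`∑_k |k|³‖û(t,k)‖² ≥ c₀ ν/(T − t)` for all `t ∈ [a, T)` — the exact exponent at the
`Ḣ^{3/2}` level, companion of the Wiener-algebra rate `∑_k‖û(t,k)‖ ≥ (ν/(T−t))^{1/2}`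
(`Torus.wienerNorm_blowup_rate_of_not_bddAbove_gradNormSq`).
[cite: CortissozMontero2015, §2 Thm 2.1 (arXiv p. 4); RobinsonSadowskiSilva2012, §II (2.2)] -/
theorem hsSeminorm_sq_three_halves_blowup_rate_of_not_bddAbove_gradNormSq
    (hd : Fintype.card d = 3) :
    ∃ c₀ : ℝ, 0 < c₀ ∧ ∀ {ν a T : ℝ}, 0 < ν →
      ∀ {u : ℝ → UnitAddTorus d → EuclideanSpace ℝ d} {p : ℝ → UnitAddTorus d → ℝ},
      Torus.IsClassicalNSSolutionOn (Ico a T) ν 0 u p → (∀ t ∈ Ico a T, HasZeroMean (u t)) →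
      ¬ BddAbove ((fun t => Torus.gradNormSq (u t)) '' Ico a T) →
      ∀ t ∈ Ico a T, c₀ * ν / (T - t) ≤
        ∑' k : d → ℤ, freqNormSq k ^ (3 / 2 : ℝ) *
          ‖mFourierCoeff (EuclideanSpace.complexify ∘ u t) k‖ ^ 2 := by
  obtain ⟨c₀, hc₀, H⟩ := hsSeminorm_sq_blowup_rate_of_not_bddAbove_gradNormSq'' hd (s := 3 / 2)
    (by norm_num) (by norm_num)
  refine ⟨c₀, hc₀, fun {ν a T} hν {u p} h hmean hunb t ht => ?_⟩
  have h1 := H hν h hmean hunb t ht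
  have e1 : ((5 : ℝ) - 2 * (3 / 2)) / (2 * (3 / 2) - 1) = 1 := by norm_num
  have e2 : ((2 : ℝ) * (3 / 2) - 1) / 2 = 1 := by norm_num
  rw [e1, e2, Real.rpow_one, Real.rpow_one] at h1
  exact h1

/-- **The `Ḣ^{3/2}` lifespan bound** (Cortissoz–Montero 2015, Cor. 2.1 at `s = 3/2`:
"`K_s/(‖u₀‖_s)^{4/(2s−1)} ≤ T`", here `4/(2s−1) = 2`), classical continuation form on `T³` with the
viscosity explicit: for `card d = 3` there is `c₀ > 0` such that a classical mean-zero solution of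
the unforced equations on `[0, T) × T³` (`ν > 0`, `T > 0`) with `T · ‖u(0)‖²_{Ḣ^{3/2}} ≤ c₀ ν`
keeps `‖u(t)‖²_{Ḣ^{3/2}} ≤ 2‖u(0)‖²_{Ḣ^{3/2}}` on `[0, T)` and continues classically past `T`.
[cite: CortissozMontero2015, §2 Cor 2.1 (arXiv p. 5)] -/
theorem classicalNS_continuation_of_hsSeminorm_three_halves_lifespan (hd : Fintype.card d = 3) :
    ∃ c₀ : ℝ, 0 < c₀ ∧ ∀ {ν T : ℝ}, 0 < ν → 0 < T →
      ∀ {u : ℝ → UnitAddTorus d → EuclideanSpace ℝ d} {p : ℝ → UnitAddTorus d → ℝ},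
      Torus.IsClassicalNSSolutionOn (Ico 0 T) ν 0 u p → (∀ t ∈ Ico 0 T, HasZeroMean (u t)) →
      T * (∑' k : d → ℤ, freqNormSq k ^ (3 / 2 : ℝ) *
          ‖mFourierCoeff (EuclideanSpace.complexify ∘ u 0) k‖ ^ 2) ≤ c₀ * ν →
      (∀ t ∈ Ico 0 T, (∑' k : d → ℤ, freqNormSq k ^ (3 / 2 : ℝ) *
          ‖mFourierCoeff (EuclideanSpace.complexify ∘ u t) k‖ ^ 2) ≤
        2 * ∑' k : d → ℤ, freqNormSq k ^ (3 / 2 : ℝ) *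
          ‖mFourierCoeff (EuclideanSpace.complexify ∘ u 0) k‖ ^ 2) ∧
      ∃ T' : ℝ, T < T' ∧ ∃ (u' : ℝ → UnitAddTorus d → EuclideanSpace ℝ d)
        (p' : ℝ → UnitAddTorus d → ℝ), Torus.IsClassicalNSSolutionOn (Icc 0 T') ν 0 u' p' ∧
          (∀ t ∈ Icc 0 T', HasZeroMean (u' t)) ∧ ∀ t ∈ Ico 0 T, u' t = u t := by
  obtain ⟨c₀, hc₀, H⟩ := classicalNS_continuation_of_hsSeminorm_lifespan'' hd (s := 3 / 2)
    (by norm_num) (by norm_num)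
  refine ⟨c₀, hc₀, fun {ν T} hν hT {u p} h hmean hsmall => ?_⟩
  have e1 : ((5 : ℝ) - 2 * (3 / 2)) / (2 * (3 / 2) - 1) = 1 := by norm_num
  have e2 : (2 : ℝ) / (2 * (3 / 2) - 1) = 1 := by norm_num
  have e3 : ((2 : ℝ) * (3 / 2) - 1) / 2 = 1 := by norm_num
  have H' := @H ν T hν hT u p h hmean
  rw [e1, e2, e3, Real.rpow_one, Real.rpow_one, Real.rpow_one] at H'
  exact H' hsmall

end NSSobolev

end Literature.Analysis.FluidPDE

end

/-! ### §6 (appended 2026-08-24, lit g39) The WEAK `Ḣ^{5/2}` blow-up estimate at the optimal rate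
(McCormick–Olson–Robinson–Rodrigo–Vidal-López–Zhou 2016, Thm 3.2)

Search for candidate a priori estimates; no regularity claim.

Source: D. S. McCormick, E. J. Olson, J. C. Robinson, J. L. Rodrigo, A. Vidal-López, Y. Zhou,
*Lower bounds on blowing-up solutions of the three-dimensional Navier–Stokes equations in
`Ḣ^{3/2}`, `Ḣ^{5/2}`, and `Ḃ^{5/2}_{2,1}`*, SIAM J. Math. Anal. 48 (2016) 2119–2132
[MccormickEtAl2016] (held: paper:doi-10-1137-15m1017776, pp. 2123–2124 READ): §2 Lemma 2.1 (the ODE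
lemma), §3 Thm 3.1 (3.1) (the strong `Ḣ^{3/2}` rate — here §5 above, after Cortissoz–Montero) and

  Theorem 3.2. Suppose that `u` is a classical solution of the Navier–Stokes equations with
  maximal existence time `T`. Then `limsup_{t↑T} (T − t)‖u(t)‖_{Ḣ^{5/2}} ≥ c`.   (3.2)

proved "by contradiction": if `‖u(t)‖_{Ḣ^{5/2}} ≤ ε(T − t)^{−1}` for `τ ≤ t < T` (3.3) with
`2c_{3/2}ε < 1`, then the `Ḣ^{3/2}` inequality `½ d/dt‖u‖²_{3/2} ≤ c_{3/2}‖u‖²_{3/2}‖u‖_{5/2} −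
‖u‖²_{5/2}`, the monotonicity of `ax − x²` on `x ≤ a/2`, the strong rate (3.1) and the integrating
factor `(T − t)^{2c_{3/2}ε}` give `‖u(t)‖²_{3/2} ≤ C_τ (T − t)^{−2c_{3/2}ε}`, contradicting (3.1).
Printed for classical solutions on `ℝ³`; the printed proof uses only the `Ḣ^{3/2}` energy
inequality and (3.1), both available on `T³` (§2 and §5 above; Robinson–Rodrigo–Sadowski 2016
(17.28)), and is followed here verbatim on `T³`, with the viscosity kept: inputs
`NSSobolev.hsSeminorm_sq_deriv_le_of_eq_three_halves` (`X' ≤ −8π²νZ + K X √Z`) and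
`NSSobolev.hsSeminorm_sq_three_halves_blowup_rate` (`X ≥ c₀ν/(T − t)`); output: an absolute
`c₁ > 0` (no power of `ν` — `‖·‖_{Ḣ^{5/2}}` scales like `1/time`) with, for every `τ < T`, SOME
`t ∈ [τ, T)` such that `∑_k |k|⁵‖û(t,k)‖² > (c₁/(T − t))²`:

* `NSSobolev.hsSeminorm_sq_five_halves_weak_blowup_rate` (under `Ḣ^{3/2}`-unboundedness),
* `NSSobolev.hsSeminorm_sq_five_halves_weak_blowup_rate_of_not_bddAbove_gradNormSq` (under
  enstrophy-unboundedness = no classical continuation past `T`),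
* `NSSobolev.frequently_le_mul_hsSeminorm_five_halves` (filter form `∃ᶠ t in 𝓝[<] T,
  c₁ ≤ (T − t)·(∑_k |k|⁵‖û(t,k)‖²)^{1/2}`, i.e. `limsup ≥ c₁`).

HONEST SCOPE: WEAK = along a sequence of times only; the STRONG `Ḣ^{5/2}` rate
`‖u(t)‖_{Ḣ^{5/2}} ≥ c/(T − t)` for all `t` is NOT typed and is open in print (the tree keeps the
all-`t` `ε`-family `NSSobolev.hsSeminorm_sq_blowup_rate_five_halves`); their `Ḃ^{5/2}_{2,1}(ℝ³)`
strong rate (Thm 4.1) and the dyadic Sobolev inequality (5.5)/Prop. 5.1 are NOT typed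
(Littlewood–Paley; cf. Davies–Koch, SIAM J. Math. Anal. 2023, arXiv:2203.12993, strong rates in
`Ḃ^{s_p+2}_{p,1}(ℝⁿ)` only). For the functional-mining cell: the `s = 5/2` entry of the `Ḣ^s`
yardstick index (EXTREME-GROWTH G8Σ) gains the optimal exponent `1` along a sequence — a NECESSARY
condition on blow-up, not an a priori bound, no regularity claim. Tree search
(`five_halves_weak|weak_blowup|frequently_le_mul_hsSeminorm`): nothing. -/

noncomputable section

open MeasureTheory Set Filter UnitAddTorus Function Finset
open scoped Topology BigOperators InnerProductSpace ComplexConjugate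

namespace Literature.Analysis.FluidPDE

namespace NSSobolev

open Literature.Analysis.FunctionSpaces Literature.Analysis.FunctionSpaces.Torus NSGevrey

variable {d : Type*} [Fintype d] [DecidableEq d]

/-- Unboundedness of the `Ḣ^s` energy (`s ≥ 1`) from unboundedness of the enstrophy, for smooth
slices: `‖∇u‖₂² = 4π² ∑_k |k|²‖û(k)‖² ≤ 4π² ∑_k |k|^{2s}‖û(k)‖²` (Parseval). [folklore] -/
private theorem not_bddAbove_hsSeminorm_sq_of_not_bddAbove_gradNormSq {S : Set ℝ} {s : ℝ}
    (hs1 : 1 ≤ s) {u : ℝ → UnitAddTorus d → EuclideanSpace ℝ d}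
    (hu : ∀ t ∈ S, IsSmooth (u t))
    (hunb : ¬ BddAbove ((fun t => Torus.gradNormSq (u t)) '' S)) :
    ¬ BddAbove ((fun t => ∑' k : d → ℤ, freqNormSq k ^ s *
          ‖mFourierCoeff (EuclideanSpace.complexify ∘ u t) k‖ ^ 2) '' S) := by
  classical
  intro hbdd
  apply hunb
  obtain ⟨M, hM⟩ := hbdd
  refine ⟨4 * Real.pi ^ 2 * M, ?_⟩
  rintro _ ⟨τ, hτ, rfl⟩
  have hX : ∑' k : d → ℤ, freqNormSq k ^ s *
      ‖mFourierCoeff (EuclideanSpace.complexify ∘ u τ) k‖ ^ 2 ≤ M := hM ⟨τ, hτ, rfl⟩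
  have huτ : IsSmooth (u τ) := hu τ hτ
  have hG := hasSum_freqNormSq_mul_norm_sq_mFourierCoeff huτ
  have hXs := huτ.summable_freqNormSq_rpow_mul_norm_sq (by linarith : (0 : ℝ) ≤ s)
  have hle : Torus.gradNormSq (u τ) ≤ 4 * Real.pi ^ 2 * ∑' k : d → ℤ, freqNormSq k ^ s *
      ‖mFourierCoeff (EuclideanSpace.complexify ∘ u τ) k‖ ^ 2 := by
    rw [← hG.tsum_eq, ← tsum_mul_left]
    refine Summable.tsum_le_tsum (fun k => ?_) hG.summable (hXs.mul_left _)
    rw [← mul_assoc]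
    refine mul_le_mul_of_nonneg_right (mul_le_mul_of_nonneg_left ?_ (by positivity)) (sq_nonneg _)
    by_cases hk : k = 0
    · rw [hk, freqNormSq_zero, Real.zero_rpow (by linarith)]
    · calc freqNormSq k = freqNormSq k ^ (1 : ℝ) := (Real.rpow_one _).symm
        _ ≤ freqNormSq k ^ s :=
            Real.rpow_le_rpow_of_exponent_le (one_le_freqNormSq_of_ne_zero hk) hs1
  show Torus.gradNormSq (u τ) ≤ 4 * Real.pi ^ 2 * M
  exact hle.trans (mul_le_mul_of_nonneg_left hX (by positivity))

/-- **McCormick–Olson–Robinson–Rodrigo–Vidal-López–Zhou 2016, Theorem 3.2 — the WEAK blow-up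
estimate in `Ḣ^{5/2}` at the optimal rate, on `T³`** ("Suppose that `u` is a classical solution
of the Navier–Stokes equations with maximal existence time `T`. Then
`limsup_{t↑T} (T − t)‖u(t)‖_{Ḣ^{5/2}} ≥ c` (3.2)"; proof: "by contradiction … suppose that for
`τ ≤ t ≤ T`, `‖u(t)‖_{Ḣ^{5/2}} ≤ ε(T − t)^{−1}` (3.3) … `½ d/dt‖u‖²_{3/2} ≤
c_{3/2}‖u‖²_{3/2}‖u‖_{5/2} − ‖u‖²_{5/2}`. Since `ax − x²` is increasing in `x` while `x ≤ a/2`,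
using (3.3) along with (3.1) … `d/dt‖u‖²_{3/2} ≤ 2c_{3/2}‖u‖²_{3/2} ε/(T−t) − 2ε²/(T−t)²`. Using
the integrating factor `(T − t)^{2c_{3/2}ε}` (note that the exponent is `< 1`) … `‖u(t)‖²_{3/2} ≤
C_τ(T − t)^{−2c_{3/2}ε}`, which contradicts (3.1) … Note that this bound does not use directly any
differential inequality governing the evolution of `‖u‖_{Ḣ^{5/2}}`"; printed for classical
solutions on `ℝ³` — the printed proof uses only the `Ḣ^{3/2}` energy inequality and the strong
`Ḣ^{3/2}` rate (3.1), both available on `T³` (Cortissoz–Montero 2015; Robinson–Rodrigo–Sadowski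
2016 (17.28)), and is followed here verbatim on `T³`), classical torus form with
the viscosity explicit, the inputs being the borderline `Ḣ^{3/2}` law
`X' ≤ −8π²νZ + K X √Z` (`NSSobolev.hsSeminorm_sq_deriv_le_of_eq_three_halves`) and the strong
`Ḣ^{3/2}` rate `X ≥ c₀ν/(T − t)` (`NSSobolev.hsSeminorm_sq_three_halves_blowup_rate`): for
`card d = 3` there is an absolute `c₁ > 0` such that every classical mean-zero solution of the
unforced equations (`ν > 0`) on `[a, T) × T³` whose `Ḣ^{3/2}` energy is unbounded on `[a, T)`
satisfies, for every `τ ∈ [a, T)`, `∑_k |k|⁵‖û(t,k)‖² > (c₁/(T − t))²` for SOME `t ∈ [τ, T)` —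
i.e. `limsup_{t↑T} (T − t)‖u(t)‖_{Ḣ^{5/2}} ≥ c₁` (no power of `ν`: `Ḣ^{5/2}` scales like `1/time`).
The strong form `‖u(t)‖_{Ḣ^{5/2}} ≥ c/(T − t)` for ALL `t` is NOT claimed (open in print; the tree
has the `ε`-family `NSSobolev.hsSeminorm_sq_blowup_rate_five_halves`, and the strong rate holds in
`Ḃ^{5/2}_{2,1}(ℝ³)`, their Thm 4.1, not typed here).
[cite: MccormickEtAl2016, §3 Thm 3.2 with (3.3) and Lemma 2.1
(SIAM J. Math. Anal. 48, pp. 2123–2124)] -/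
theorem hsSeminorm_sq_five_halves_weak_blowup_rate (hd : Fintype.card d = 3) :
    ∃ c₁ : ℝ, 0 < c₁ ∧ ∀ {ν a T : ℝ}, 0 < ν →
      ∀ {u : ℝ → UnitAddTorus d → EuclideanSpace ℝ d} {p : ℝ → UnitAddTorus d → ℝ},
      Torus.IsClassicalNSSolutionOn (Ico a T) ν 0 u p → (∀ t ∈ Ico a T, HasZeroMean (u t)) →
      ¬ BddAbove ((fun t => ∑' k : d → ℤ, freqNormSq k ^ (3 / 2 : ℝ) *
          ‖mFourierCoeff (EuclideanSpace.complexify ∘ u t) k‖ ^ 2) '' Ico a T) →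
      ∀ τ ∈ Ico a T, ∃ t ∈ Ico τ T, (c₁ / (T - t)) ^ 2 <
        ∑' k : d → ℤ, freqNormSq k ^ (5 / 2 : ℝ) *
          ‖mFourierCoeff (EuclideanSpace.complexify ∘ u t) k‖ ^ 2 := by
  classical
  have hn : (Fintype.card d : ℝ) = 3 := by rw [hd]; norm_num
  obtain ⟨K, hK0, hlaw⟩ := hsSeminorm_sq_deriv_le_of_eq_three_halves hd (s := 3 / 2) rfl
  obtain ⟨c₀, hc₀, hrate⟩ := hsSeminorm_sq_three_halves_blowup_rate hd
  set K' : ℝ := max K 1 with hK'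
  have hK'1 : 1 ≤ K' := le_max_right _ _
  have hK'0 : 0 < K' := lt_of_lt_of_le one_pos hK'1
  have hKK' : K ≤ K' := le_max_left _ _
  set ε : ℝ := min (K' * c₀ / (16 * Real.pi ^ 2)) (1 / (2 * K')) with hε
  have hε0 : 0 < ε := lt_min (by positivity) (by positivity)
  have hε1 : ε ≤ K' * c₀ / (16 * Real.pi ^ 2) := min_le_left _ _
  have hε2 : ε ≤ 1 / (2 * K') := min_le_right _ _
  have hKε : K' * ε < 1 := by
    have h1 : K' * ε ≤ K' * (1 / (2 * K')) := mul_le_mul_of_nonneg_left hε2 hK'0.le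
    have h2 : K' * (1 / (2 * K')) = 1 / 2 := by field_simp
    linarith
  refine ⟨ε, hε0, fun {ν a T} hν {u p} h hmean hunb τ hτ => ?_⟩
  -- notation
  set X : ℝ → ℝ := fun t => ∑' k : d → ℤ, freqNormSq k ^ (3 / 2 : ℝ) *
    ‖mFourierCoeff (EuclideanSpace.complexify ∘ u t) k‖ ^ 2 with hX
  set Z : ℝ → ℝ := fun t => ∑' k : d → ℤ, freqNormSq k ^ (5 / 2 : ℝ) *
    ‖mFourierCoeff (EuclideanSpace.complexify ∘ u t) k‖ ^ 2 with hZ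
  have hXnn : ∀ t, 0 ≤ X t := fun t => tsum_nonneg fun k =>
    mul_nonneg (Real.rpow_nonneg (freqNormSq_nonneg k) _) (sq_nonneg _)
  have hZnn : ∀ t, 0 ≤ Z t := fun t => tsum_nonneg fun k =>
    mul_nonneg (Real.rpow_nonneg (freqNormSq_nonneg k) _) (sq_nonneg _)
  -- the strong `Ḣ^{3/2}` rate (3.1) on `[a, T)`
  have hR : ∀ t ∈ Ico a T, c₀ * ν / (T - t) ≤ X t := fun t ht => hrate hν h hmean hunb t ht
  by_contra hcon
  push Not at hcon
  -- `hcon : ∀ t ∈ Ico τ T, Z t ≤ (ε / (T - t)) ^ 2` — the negation (3.3) of the claim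
  set γ : ℝ := K' * ε with hγ
  have hγ0 : 0 < γ := mul_pos hK'0 hε0
  have hγ1 : γ < 1 := hKε
  -- Step 1: on `(τ, T)` the law gives `X' ≤ γ X/(T - t)`, so `X (T - t)^γ` is non-increasing
  have hanti : ∀ t ∈ Ico τ T, X t * (T - t) ^ γ ≤ X τ * (T - τ) ^ γ := by
    intro t ht
    rcases ht.1.eq_or_lt with h0 | hτt
    · rw [h0]
    have htT : t < T := ht.2
    have hsub : Icc τ t ⊆ Ico a T := fun r hr => ⟨hτ.1.trans hr.1, lt_of_le_of_lt hr.2 htT⟩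
    have h' : Torus.IsClassicalNSSolutionOn (Icc τ t) ν 0 u p :=
      h.mono hsub (uniqueDiffOn_Icc hτt)
    have hmean' : ∀ r ∈ Icc τ t, HasZeroMean (u r) := fun r hr => hmean r (hsub hr)
    -- the comparison function
    set φ : ℝ → ℝ := fun r => X r * (T - r) ^ γ with hφ
    have hpos : ∀ r ∈ Icc τ t, 0 < T - r := fun r hr => by linarith [hr.2]
    have hXc : ContinuousOn X (Icc τ t) :=
      continuousOn_tsum_rpow_mul_norm_sq hτt h'.smooth_velocity (by norm_num)
        (by rw [hn]; norm_num)
    have hwc : ContinuousOn (fun r : ℝ => (T - r) ^ γ) (Icc τ t) :=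
      (continuousOn_const.sub continuousOn_id).rpow_const fun r hr => Or.inl (hpos r hr).ne'
    have hφc : ContinuousOn φ (Icc τ t) := hXc.mul hwc
    -- derivative of `φ` inside, and its sign
    have hderiv : ∀ r ∈ Ioo τ t, ∃ D : ℝ, HasDerivAt X D r ∧ D ≤ γ / (T - r) * X r := by
      intro r hr
      obtain ⟨D, hD, hDle⟩ := hlaw hν hτt h' hmean' r hr
      refine ⟨D, hD, ?_⟩
      have hrT : r ∈ Ico τ T := ⟨hr.1.le, hr.2.trans htT⟩
      have hTr : 0 < T - r := by linarith [hr.2]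
      have e1 : (3 / 2 : ℝ) + 1 / 2 = 2 := by norm_num
      have e2 : (5 / 2 : ℝ) - 3 / 2 = 1 := by norm_num
      have e3 : (3 / 2 : ℝ) + 1 = 5 / 2 := by norm_num
      rw [e1, e2, e3, Real.rpow_two, Real.rpow_one, Real.sq_sqrt (hXnn r)] at hDle
      -- `hDle : D ≤ -(8π²ν) Z r + K * X r * √(Z r)`
      set y : ℝ := Real.sqrt (Z r) with hy
      have hDle' : D ≤ -(8 * Real.pi ^ 2 * ν) * Z r + K * X r * y := hDle
      have hy0 : 0 ≤ y := Real.sqrt_nonneg _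
      have hyZ : y ^ 2 = Z r := Real.sq_sqrt (hZnn r)
      set y₂ : ℝ := ε / (T - r) with hy₂
      have hy₂0 : 0 < y₂ := div_pos hε0 hTr
      -- (3.3): `y ≤ y₂`
      have hyy₂ : y ≤ y₂ := by
        have h1 : Z r ≤ y₂ ^ 2 := hcon r hrT
        calc y = Real.sqrt (Z r) := rfl
          _ ≤ Real.sqrt (y₂ ^ 2) := Real.sqrt_le_sqrt h1
          _ = y₂ := Real.sqrt_sq hy₂0.le
      -- (3.1): `X r ≥ c₀ν/(T − r)`, hence `y₂ ≤ K' X r/(16π²ν)`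
      have hXr : c₀ * ν / (T - r) ≤ X r := hR r ⟨hτ.1.trans hr.1.le, hr.2.trans htT⟩
      have hXr0 : 0 < X r := lt_of_lt_of_le (div_pos (mul_pos hc₀ hν) hTr) hXr
      have hy₂X : 16 * Real.pi ^ 2 * ν * y₂ ≤ K' * X r := by
        have h1 : y₂ ≤ K' * c₀ / (16 * Real.pi ^ 2) / (T - r) :=
          div_le_div_of_nonneg_right hε1 hTr.le
        have h2 : K' * (c₀ * ν / (T - r)) ≤ K' * X r := mul_le_mul_of_nonneg_left hXr hK'0.le
        have h3 : 16 * Real.pi ^ 2 * ν * (K' * c₀ / (16 * Real.pi ^ 2) / (T - r)) =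
            K' * (c₀ * ν / (T - r)) := by
          field_simp
        calc 16 * Real.pi ^ 2 * ν * y₂
            ≤ 16 * Real.pi ^ 2 * ν * (K' * c₀ / (16 * Real.pi ^ 2) / (T - r)) :=
              mul_le_mul_of_nonneg_left h1 (by positivity)
          _ = K' * (c₀ * ν / (T - r)) := h3
          _ ≤ K' * X r := h2
      -- `ax − bx²` is increasing in `x` for `x ≤ a/(2b)`
      have hmono : -(8 * Real.pi ^ 2 * ν) * y ^ 2 + K' * X r * y ≤
          -(8 * Real.pi ^ 2 * ν) * y₂ ^ 2 + K' * X r * y₂ := by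
        have h8 : 0 ≤ 8 * Real.pi ^ 2 * ν := by positivity
        have h1 : 8 * Real.pi ^ 2 * ν * (y + y₂) ≤ K' * X r := by
          have h9 := mul_le_mul_of_nonneg_left hyy₂ h8
          linarith
        nlinarith [h1, hyy₂, hy0, mul_nonneg (sub_nonneg.2 hyy₂) (sub_nonneg.2 h1)]
      have hKX : K * X r * y ≤ K' * X r * y :=
        mul_le_mul_of_nonneg_right (mul_le_mul_of_nonneg_right hKK' hXr0.le) hy0
      calc D ≤ -(8 * Real.pi ^ 2 * ν) * Z r + K * X r * y := hDle'
        _ ≤ -(8 * Real.pi ^ 2 * ν) * y ^ 2 + K' * X r * y := by rw [hyZ]; linarith [hKX]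
        _ ≤ -(8 * Real.pi ^ 2 * ν) * y₂ ^ 2 + K' * X r * y₂ := hmono
        _ ≤ K' * X r * y₂ := by
            have h0 : 0 ≤ 8 * Real.pi ^ 2 * ν * y₂ ^ 2 := by positivity
            linarith
        _ = γ / (T - r) * X r := by rw [hy₂, hγ]; field_simp
    have hφd : ∀ r ∈ Ioo τ t, ∃ D : ℝ, HasDerivAt X D r ∧ D ≤ γ / (T - r) * X r ∧
        HasDerivAt φ (D * (T - r) ^ γ + X r * (-1 * γ * (T - r) ^ (γ - 1))) r := by
      intro r hr
      obtain ⟨D, hD, hDle⟩ := hderiv r hr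
      have hTr : 0 < T - r := by linarith [hr.2]
      have hw : HasDerivAt (fun x : ℝ => (T - x) ^ γ) (-1 * γ * (T - r) ^ (γ - 1)) r :=
        ((hasDerivAt_id r).const_sub T).rpow_const (Or.inl hTr.ne')
      exact ⟨D, hD, hDle, hD.mul hw⟩
    have hφ' : ∀ r ∈ Ioo τ t, ∀ D : ℝ, D ≤ γ / (T - r) * X r →
        D * (T - r) ^ γ + X r * (-1 * γ * (T - r) ^ (γ - 1)) ≤ 0 := by
      intro r hr D hDle
      have hTr : 0 < T - r := by linarith [hr.2]
      have hw0 : 0 < (T - r) ^ γ := Real.rpow_pos_of_pos hTr _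
      have hsplit : (T - r) ^ (γ - 1) = (T - r) ^ γ / (T - r) := Real.rpow_sub_one hTr.ne' γ
      rw [hsplit]
      have h1 : D * (T - r) ^ γ ≤ γ / (T - r) * X r * (T - r) ^ γ :=
        mul_le_mul_of_nonneg_right hDle hw0.le
      have h2 : γ / (T - r) * X r * (T - r) ^ γ = X r * (γ * ((T - r) ^ γ / (T - r))) := by
        field_simp
      nlinarith [h1, h2]
    have hmonoφ : AntitoneOn φ (Icc τ t) := by
      refine antitoneOn_of_deriv_nonpos (convex_Icc τ t) hφc ?_ ?_
      · rw [interior_Icc]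
        intro r hr
        obtain ⟨D, hD, hDle, hφD⟩ := hφd r hr
        exact hφD.differentiableAt.differentiableWithinAt
      · rw [interior_Icc]
        intro r hr
        obtain ⟨D, hD, hDle, hφD⟩ := hφd r hr
        rw [hφD.deriv]
        exact hφ' r hr D hDle
    exact hmonoφ (left_mem_Icc.2 hτt.le) (right_mem_Icc.2 hτt.le) hτt.le
  -- Step 2: `c₀ν ≤ X(t)(T - t) ≤ Φ₀ (T - t)^{1-γ} → 0`, a contradiction
  set Φ₀ : ℝ := X τ * (T - τ) ^ γ with hΦ₀
  have hTτ : 0 < T - τ := by linarith [hτ.2]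
  have hΦ₀0 : 0 < Φ₀ := mul_pos (lt_of_lt_of_le (div_pos (mul_pos hc₀ hν) hTτ) (hR τ hτ))
    (Real.rpow_pos_of_pos hTτ _)
  have hkey : ∀ t ∈ Ico τ T, c₀ * ν ≤ Φ₀ * (T - t) ^ (1 - γ) := by
    intro t ht
    have htT : 0 < T - t := by linarith [ht.2]
    have h1 : c₀ * ν / (T - t) ≤ X t := hR t ⟨hτ.1.trans ht.1, ht.2⟩
    have h2 : X t * (T - t) ^ γ ≤ Φ₀ := hanti t ht
    have h3 : c₀ * ν ≤ X t * (T - t) := by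
      have := mul_le_mul_of_nonneg_right h1 htT.le
      rwa [div_mul_cancel₀ _ htT.ne'] at this
    have h4 : X t * (T - t) = X t * (T - t) ^ γ * (T - t) ^ (1 - γ) := by
      rw [mul_assoc, ← Real.rpow_add htT, add_sub_cancel, Real.rpow_one]
    calc c₀ * ν ≤ X t * (T - t) := h3
      _ = X t * (T - t) ^ γ * (T - t) ^ (1 - γ) := h4
      _ ≤ Φ₀ * (T - t) ^ (1 - γ) :=
          mul_le_mul_of_nonneg_right h2 (Real.rpow_nonneg htT.le _)
  -- choose `t` close to `T`
  set δ₀ : ℝ := (c₀ * ν / (2 * Φ₀)) ^ (1 / (1 - γ)) with hδ₀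
  have hq0 : 0 < c₀ * ν / (2 * Φ₀) := div_pos (mul_pos hc₀ hν) (by positivity)
  have hδ₀0 : 0 < δ₀ := Real.rpow_pos_of_pos hq0 _
  set t₀ : ℝ := max τ (T - δ₀) with ht₀
  have ht₀τ : τ ≤ t₀ := le_max_left _ _
  have ht₀T : t₀ < T := max_lt hτ.2 (by linarith)
  have hTt₀ : 0 < T - t₀ := by linarith
  have hTt₀' : T - t₀ ≤ δ₀ := by
    have : T - δ₀ ≤ t₀ := le_max_right _ _
    linarith
  have h1γ : 0 < 1 - γ := by linarith
  have hpow : (T - t₀) ^ (1 - γ) ≤ c₀ * ν / (2 * Φ₀) := by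
    calc (T - t₀) ^ (1 - γ) ≤ δ₀ ^ (1 - γ) := Real.rpow_le_rpow hTt₀.le hTt₀' h1γ.le
      _ = c₀ * ν / (2 * Φ₀) := by
          rw [hδ₀, ← Real.rpow_mul hq0.le, one_div_mul_cancel h1γ.ne', Real.rpow_one]
  have hk := hkey t₀ ⟨ht₀τ, ht₀T⟩
  have : Φ₀ * (T - t₀) ^ (1 - γ) ≤ Φ₀ * (c₀ * ν / (2 * Φ₀)) :=
    mul_le_mul_of_nonneg_left hpow hΦ₀0.le
  rw [show Φ₀ * (c₀ * ν / (2 * Φ₀)) = c₀ * ν / 2 by field_simp] at this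
  linarith [mul_pos hc₀ hν]

/-- **The weak `Ḣ^{5/2}` estimate read off the enstrophy** (McCormick et al. 2016 Thm 3.2,
classical torus form): for `card d = 3` there is `c₁ > 0` such that every classical mean-zero
solution of the unforced equations (`ν > 0`) on `[a, T) × T³` with `‖∇u(t)‖₂²` unbounded on
`[a, T)` (no classical continuation past `T`) satisfies, for every `τ ∈ [a, T)`,
`∑_k |k|⁵‖û(t,k)‖² > (c₁/(T − t))²` for some `t ∈ [τ, T)` (the `Ḣ^{3/2}` energy dominates the
enstrophy and is unbounded too; then `NSSobolev.hsSeminorm_sq_five_halves_weak_blowup_rate`).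
[cite: MccormickEtAl2016, §3 Thm 3.2 (SIAM J. Math. Anal. 48, p. 2123)] -/
theorem hsSeminorm_sq_five_halves_weak_blowup_rate_of_not_bddAbove_gradNormSq
    (hd : Fintype.card d = 3) :
    ∃ c₁ : ℝ, 0 < c₁ ∧ ∀ {ν a T : ℝ}, 0 < ν →
      ∀ {u : ℝ → UnitAddTorus d → EuclideanSpace ℝ d} {p : ℝ → UnitAddTorus d → ℝ},
      Torus.IsClassicalNSSolutionOn (Ico a T) ν 0 u p → (∀ t ∈ Ico a T, HasZeroMean (u t)) →
      ¬ BddAbove ((fun t => Torus.gradNormSq (u t)) '' Ico a T) →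
      ∀ τ ∈ Ico a T, ∃ t ∈ Ico τ T, (c₁ / (T - t)) ^ 2 <
        ∑' k : d → ℤ, freqNormSq k ^ (5 / 2 : ℝ) *
          ‖mFourierCoeff (EuclideanSpace.complexify ∘ u t) k‖ ^ 2 := by
  obtain ⟨c₁, hc₁, H⟩ := hsSeminorm_sq_five_halves_weak_blowup_rate hd
  refine ⟨c₁, hc₁, fun {ν a T} hν {u p} h hmean hunb τ hτ => H hν h hmean ?_ τ hτ⟩
  exact not_bddAbove_hsSeminorm_sq_of_not_bddAbove_gradNormSq (by norm_num)
    (fun t ht => h.smooth_velocity.isSmooth_slice ht) hunb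

/-- **`limsup_{t↑T} (T − t)‖u(t)‖_{Ḣ^{5/2}} ≥ c₁`, filter form** of
`NSSobolev.hsSeminorm_sq_five_halves_weak_blowup_rate_of_not_bddAbove_gradNormSq`: along a
classical mean-zero solution on `[a, T) × T³` with unbounded enstrophy, FREQUENTLY as `t → T⁻`,
`c₁ ≤ (T − t) · (∑_k |k|⁵‖û(t,k)‖²)^{1/2}`.
[cite: MccormickEtAl2016, §3 Thm 3.2 (3.2)] -/
theorem frequently_le_mul_hsSeminorm_five_halves (hd : Fintype.card d = 3) :
    ∃ c₁ : ℝ, 0 < c₁ ∧ ∀ {ν a T : ℝ}, 0 < ν →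
      ∀ {u : ℝ → UnitAddTorus d → EuclideanSpace ℝ d} {p : ℝ → UnitAddTorus d → ℝ},
      Torus.IsClassicalNSSolutionOn (Ico a T) ν 0 u p → (∀ t ∈ Ico a T, HasZeroMean (u t)) →
      ¬ BddAbove ((fun t => Torus.gradNormSq (u t)) '' Ico a T) →
      ∃ᶠ t in 𝓝[<] T, c₁ ≤ (T - t) * Real.sqrt (∑' k : d → ℤ, freqNormSq k ^ (5 / 2 : ℝ) *
          ‖mFourierCoeff (EuclideanSpace.complexify ∘ u t) k‖ ^ 2) := by
  obtain ⟨c₁, hc₁, H⟩ := hsSeminorm_sq_five_halves_weak_blowup_rate_of_not_bddAbove_gradNormSq hd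
  refine ⟨c₁, hc₁, fun {ν a T} hν {u p} h hmean hunb => ?_⟩
  have haT : a < T := by
    by_contra hle
    rw [not_lt] at hle
    apply hunb
    rw [Set.Ico_eq_empty (not_lt.2 hle), Set.image_empty]
    exact bddAbove_empty
  rw [Filter.frequently_iff]
  intro U hU
  obtain ⟨l, hlT, hl⟩ := mem_nhdsLT_iff_exists_Ioo_subset.1 hU
  have hlT' : l < T := hlT
  -- a point of `[max a l', T)` inside `U`
  set τ : ℝ := max a ((l + T) / 2) with hτ
  have hτa : a ≤ τ := le_max_left _ _
  have hτT : τ < T := max_lt haT (by linarith)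
  have hlτ : l < τ := lt_of_lt_of_le (by linarith) (le_max_right _ _)
  obtain ⟨t, ht, hlt⟩ := H hν h hmean hunb τ ⟨hτa, hτT⟩
  refine ⟨t, hl ⟨hlτ.trans_le ht.1, ht.2⟩, ?_⟩
  have hTt : 0 < T - t := by linarith [ht.2]
  have h1 : c₁ / (T - t) < Real.sqrt (∑' k : d → ℤ, freqNormSq k ^ (5 / 2 : ℝ) *
      ‖mFourierCoeff (EuclideanSpace.complexify ∘ u t) k‖ ^ 2) := by
    have h0 : 0 ≤ c₁ / (T - t) := (div_pos hc₁ hTt).le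
    calc c₁ / (T - t) = Real.sqrt ((c₁ / (T - t)) ^ 2) := (Real.sqrt_sq h0).symm
      _ < _ := Real.sqrt_lt_sqrt (sq_nonneg _) hlt
  have h2 := (mul_lt_mul_of_pos_left h1 hTt)
  rw [mul_div_cancel₀ _ hTt.ne'] at h2
  exact h2.le

end NSSobolev

end Literature.Analysis.FluidPDE

end
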